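import Literature.NumberTheory.LFunctions.RealCharacterDivisorSumsLevel
import Literature.NumberTheory.LFunctions.DirichletConvOneChiSum
import Literature.NumberTheory.LFunctions.SiegelTheorem
import Literature.NumberTheory.Sieve.IwaniecAlmostPrimesQuadraticMertens
import Literature.NumberTheory.Sieve.PolynomialCongruencesRootCount
import Literature.NumberTheory.Sieve.PolynomialCongruencesLemmas
import Mathlib.NumberTheory.ZetaValues
import HarnessLib

/-!
# Logarithmic sums of the root count `ρ_G` of a quadratic over the multiples of `e`

Topic `Literature/NumberTheory/Sieve`.  For an irreducible quadratic `G = aX² + bX + c ∈ ℤ[X]`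
(`a > 0`) with root count `ρ_G(n) = #{ν mod n : G(ν) ≡ 0}` (`Iwaniec1978.rhoG`) and a squarefree
"bad modulus" `Q` (even, divisible by the primes dividing `aΔ`, `Δ = b² − 4ac`, and such that
`ρ_G(p^k) = ρ_G(p)` for `p ∤ Q`, `k ≥ 1`), this file PROVES the main-term asymptotics that a sieve
on the cofactor `m` of `G(t) = p₁ · m · ℓ` needs (the "type I main terms" of the lower-bound
construction of `n`-smooth values of quadratics, property S of Teräväinen 2024, Def. 2.9 /
Prop. 2.11; companion of `LiouvillePolynomialValues*.lean`):

* `abs_rhoSum_sub_main_le` — **level of distribution of `ρ_G` on `(n, Q) = 1`**: for `e`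
  squarefree and prime to `Q`, `N ≥ 1`,
  `|∑_{n ≤ N, e ∣ n, (n,Q)=1} ρ_G(n) − 𝔠 g(e) N| ≤ (5q₀τ(Q)³(1 + log N) + 8|L(1,χ)F_Q|) τ(e)³ √N`,
  where `χ = χ_Δ = (Δ/·)` (mod `q₀ = 4|Δ|`), `𝔠 = L(1,χ) F_Q Z_Q > 0` (`const_pos`),
  `F_Q = ∏_{p ∣ Q}(1 − 1/p)(1 − χ(p)/p)`, `Z_Q = ∑_{(t,Q)=1} μ(t)/t²` (`zCoprime`), and
  `g = rhoDensity` is the multiplicative density `g(p) = ρ_G(p)/(p − 1 + ρ_G(p))` (`p ∤ Q`),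
  `g(p) = 0` (`p ∣ Q`);
* `abs_rhoLogSum_sub_le` — the logarithmic window version
  `∑_{U<m≤V, e∣m, (m,Q)=1} ρ_G(m)/m = 𝔠 g(e) log(V/U) + O(τ(e)³ (1 + log V)/√U)` (partial
  summation, `abs_logSum_sub_le`), and `abs_rhoLogSum_prime_mul_sub_le` — replacing `ρ_G(m)` by
  `ρ_G(p₁m)` for a prime `p₁ ∤ Q` costs `O((1 + log V)²/p₁)`.

Method (all elementary given the tree): `ρ_G = λ ∗ r` on the integers prime to `Q`
(`rhoG_eq_sqMoebius_mul_charDivisorSum`; `r = χ ∗ 1 = RealChar.charDivisorSum`, `λ(d²) = μ(d)`),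
the hyperbola rearrangement and Möbius detection of `(k, Q) = 1` (`rhoSum_eq_sum_sqrt`), the
tree's level-of-distribution estimate for `r` (`RealChar.abs_congrSum_charDivisorSum_sub_le`,
`|∑_{n ≤ x, d ∣ n} r(n) − g_r(d) L(1,χ) x| ≤ 5q₀√x τ(d)²/√d`), the `gcd`-splitting of the
singular sum and the Euler factor swap `Z_Q = ∏_{p∣e}(1 − p^{−2}) Z_{eQ}`
(`abs_singularSum_sub_le`, `zCoprime_eq_prod_mul`), `L(1,χ) > 0`
(`Siegel.LFunction_one_re_pos`), and non-principality of `χ_Δ` for EVERY irreducible `G`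
(`chi_ne_one`: reduction to an odd constant term through the reversed polynomial or `G(X+1)`,
then the tree's `Iwaniec1978.ne_one_of_forall_odd`).  No statement of a paper is vendored; no named
fact is introduced.

## References

* J. Teräväinen, *On the Liouville function at polynomial arguments*, Amer. J. Math. 146 (2024),
  Definition 2.9 and Proposition 2.11 (the application). [cite: Teravainen2024, Proposition 2.11]
* H. Davenport, *Multiplicative Number Theory*, Ch. 6 (the sequence `r = χ ∗ 1`, via the tree's
  `RealCharacterDivisorSums*.lean`).
* H. Halberstam, H.-E. Richert, *Sieve Methods* (1974), Ch. 1 (densities `ω(d)/d` of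
  multiplicative sequences).
-/

noncomputable section

open Finset Real

namespace Literature.NumberTheory.Sieve

namespace RhoLogSums

/-! ### A. Partial summation for logarithmic window sums -/

/-- Abel's identity in the form used here: for any `E : ℕ → ℝ` and `U ≤ V`,
`∑_{U<n≤V} (E(n) − E(n−1))/n + E(U)/(U+1) = E(V)/(V+1) + ∑_{U<n≤V} E(n)(1/n − 1/(n+1))`.
[folklore] -/
theorem sum_Ioc_sub_div_add_eq (E : ℕ → ℝ) (U : ℕ) {V : ℕ} (hUV : U ≤ V) :
    ∑ n ∈ Ioc U V, (E n - E (n - 1)) / n + E U / ((U : ℝ) + 1) =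
      E V / ((V : ℝ) + 1) + ∑ n ∈ Ioc U V, E n * (1 / (n : ℝ) - 1 / ((n : ℝ) + 1)) := by
  induction V, hUV using Nat.le_induction with
  | base => simp
  | succ V hV ih =>
      rw [Finset.sum_Ioc_succ_top (by omega), Finset.sum_Ioc_succ_top (by omega),
        add_right_comm, ih, Nat.add_sub_cancel]
      push_cast
      have hV1 : ((V : ℝ) + 1) ≠ 0 := by positivity
      have hV2 : ((V : ℝ) + 1 + 1) ≠ 0 := by positivity
      field_simp
      ring

/-- `|∑_{U<n≤V} 1/n − log(V/U)| ≤ 2/U` for `1 ≤ U ≤ V`. [folklore] -/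
theorem abs_sum_Ioc_inv_sub_log_le {U V : ℕ} (hU : 1 ≤ U) (hUV : U ≤ V) :
    |∑ n ∈ Ioc U V, (1 : ℝ) / n - Real.log ((V : ℝ) / U)| ≤ 2 / U := by
  have hV : 1 ≤ V := hU.trans hUV
  have hU0 : (0 : ℝ) < U := by exact_mod_cast hU
  have hV0 : (0 : ℝ) < V := by exact_mod_cast hV
  have hsum : ∑ n ∈ Ioc U V, (1 : ℝ) / n = (harmonic V : ℝ) - (harmonic U : ℝ) := by
    have hsplit : Icc 1 V = Icc 1 U ∪ Ioc U V := by
      ext n; simp only [mem_union, mem_Icc, mem_Ioc]; omega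
    have hdisj : Disjoint (Icc 1 U) (Ioc U V) := by
      rw [Finset.disjoint_left]; intro n h1 h2
      simp only [mem_Icc] at h1; simp only [mem_Ioc] at h2; omega
    have h1 : (harmonic V : ℝ) = ∑ n ∈ Icc 1 V, (1 : ℝ) / n := by
      rw [harmonic_eq_sum_Icc]; push_cast
      exact Finset.sum_congr rfl fun n _ => by rw [one_div]
    have h2 : (harmonic U : ℝ) = ∑ n ∈ Icc 1 U, (1 : ℝ) / n := by
      rw [harmonic_eq_sum_Icc]; push_cast
      exact Finset.sum_congr rfl fun n _ => by rw [one_div]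
    rw [h1, h2, hsplit, Finset.sum_union hdisj]
    ring
  have hHU := LFunctions.DirichletAbel.abs_harmonic_sub_log_sub_eulerMascheroni_le hU
  have hHV := LFunctions.DirichletAbel.abs_harmonic_sub_log_sub_eulerMascheroni_le hV
  rw [hsum, Real.log_div hV0.ne' hU0.ne']
  rw [abs_le] at hHU hHV ⊢
  have h1V : 1 / (V : ℝ) ≤ 1 / U := one_div_le_one_div_of_le hU0 (by exact_mod_cast hUV)
  have : (2 : ℝ) / U = 1 / U + 1 / U := by ring
  constructor <;> linarith [hHU.1, hHU.2, hHV.1, hHV.2]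

/-- `∑_{U<n≤V} 1/(n(n+1)) ≤ 1/U`-type bound: `∑_{U<n≤V} (1/n − 1/(n+1)) = 1/(U+1) − 1/(V+1)`.
[folklore] -/
theorem sum_Ioc_inv_sub_inv_succ (U : ℕ) {V : ℕ} (hUV : U ≤ V) :
    ∑ n ∈ Ioc U V, (1 / (n : ℝ) - 1 / ((n : ℝ) + 1)) = 1 / ((U : ℝ) + 1) - 1 / ((V : ℝ) + 1) := by
  induction V, hUV using Nat.le_induction with
  | base => simp
  | succ V hV ih =>
      rw [Finset.sum_Ioc_succ_top (by omega), ih]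
      push_cast
      ring

/-- For `n ≥ 1`: `√n · (1/n − 1/(n+1)) ≤ 2 (1/√n − 1/√(n+1))` (the difference is
`(√(n+1) − √n)²/(√n (n+1)) ≥ 0`). [folklore] -/
theorem sqrt_mul_inv_sub_inv_le {n : ℕ} (hn : 1 ≤ n) :
    Real.sqrt n * (1 / (n : ℝ) - 1 / ((n : ℝ) + 1)) ≤
      2 * (1 / Real.sqrt n - 1 / Real.sqrt ((n : ℝ) + 1)) := by
  have hn0 : (0 : ℝ) < n := by exact_mod_cast hn
  set s := Real.sqrt n with hs_def
  set t := Real.sqrt ((n : ℝ) + 1) with ht_def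
  have hs : 0 < s := Real.sqrt_pos.mpr hn0
  have ht : 0 < t := Real.sqrt_pos.mpr (by positivity)
  have hsq : (n : ℝ) = s ^ 2 := (Real.sq_sqrt hn0.le).symm
  have hsq1 : (n : ℝ) + 1 = t ^ 2 := (Real.sq_sqrt (by positivity : (0 : ℝ) ≤ n + 1)).symm
  rw [hsq1, hsq]
  have key : 2 * (1 / s - 1 / t) - s * (1 / s ^ 2 - 1 / t ^ 2) = (t - s) ^ 2 / (s * t ^ 2) := by
    field_simp
    ring
  have hnn : 0 ≤ (t - s) ^ 2 / (s * t ^ 2) := by positivity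
  linarith

/-- `∑_{U<n≤V} (1/√n − 1/√(n+1)) = 1/√(U+1) − 1/√(V+1) ≤ 1/√U`. [folklore] -/
theorem sum_Ioc_inv_sqrt_sub (U : ℕ) {V : ℕ} (hUV : U ≤ V) :
    ∑ n ∈ Ioc U V, (1 / Real.sqrt n - 1 / Real.sqrt ((n : ℝ) + 1)) =
      1 / Real.sqrt ((U : ℝ) + 1) - 1 / Real.sqrt ((V : ℝ) + 1) := by
  induction V, hUV using Nat.le_induction with
  | base => simp
  | succ V hV ih =>
      rw [Finset.sum_Ioc_succ_top (by omega), ih]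
      push_cast
      ring

/-- **Logarithmic window sums by partial summation.**  Let `a : ℕ → ℝ` and suppose the counting
function `A(N) = ∑_{n ≤ N} a(n)` satisfies `|A(N) − c N| ≤ B √N` for all `N ≥ 1` (`B ≥ 0`, `c`
real).  Then for `1 ≤ U ≤ V`,
`|∑_{U < n ≤ V} a(n)/n − c log(V/U)| ≤ 2|c|/U + 4B/√U`. [folklore] -/
theorem abs_logSum_sub_le {a : ℕ → ℝ} {c B : ℝ} (hB : 0 ≤ B) {U V : ℕ}
    (hA : ∀ N : ℕ, 1 ≤ N → N ≤ V → |∑ n ∈ Ioc 0 N, a n - c * N| ≤ B * Real.sqrt N)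
    (hU : 1 ≤ U) (hUV : U ≤ V) :
    |∑ n ∈ Ioc U V, a n / n - c * Real.log ((V : ℝ) / U)| ≤ 2 * |c| / U + 4 * B / Real.sqrt U := by
  have hU0 : (0 : ℝ) < U := by exact_mod_cast hU
  have hsU : 0 < Real.sqrt U := Real.sqrt_pos.mpr hU0
  -- the error function `E(N) = A(N) − cN`
  set A : ℕ → ℝ := fun N => ∑ n ∈ Ioc 0 N, a n with hAdef
  set E : ℕ → ℝ := fun N => A N - c * N with hEdef
  have hEle : ∀ N : ℕ, 1 ≤ N → N ≤ V → |E N| ≤ B * Real.sqrt N := fun N hN hNV => hA N hN hNV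
  have hE0 : E 0 = 0 := by simp [hEdef, hAdef]
  -- `a(n) = (E(n) − E(n−1)) + c` for `n ≥ 1`
  have han : ∀ n : ℕ, 1 ≤ n → a n = (E n - E (n - 1)) + c := by
    intro n hn
    have hAs : A n = A (n - 1) + a n := by
      simp only [hAdef]
      obtain ⟨k, rfl⟩ : ∃ k, n = k + 1 := ⟨n - 1, by omega⟩
      rw [Nat.add_sub_cancel, Finset.sum_Ioc_succ_top (Nat.zero_le k)]
    simp only [hEdef]
    rw [hAs]
    obtain ⟨k, rfl⟩ : ∃ k, n = k + 1 := ⟨n - 1, by omega⟩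
    rw [Nat.add_sub_cancel]; push_cast; ring
  have hsplit : ∑ n ∈ Ioc U V, a n / n =
      ∑ n ∈ Ioc U V, (E n - E (n - 1)) / n + c * ∑ n ∈ Ioc U V, (1 : ℝ) / n := by
    rw [Finset.mul_sum, ← Finset.sum_add_distrib]
    refine Finset.sum_congr rfl fun n hn => ?_
    have hn1 : 1 ≤ n := by have := (Finset.mem_Ioc.mp hn).1; omega
    rw [han n hn1]; ring
  have hAbel := sum_Ioc_sub_div_add_eq E U hUV
  have hmain := abs_sum_Ioc_inv_sub_log_le hU hUV
  -- bound the Abel pieces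
  have hEU : |E U / ((U : ℝ) + 1)| ≤ B / Real.sqrt U := by
    rw [abs_div, abs_of_pos (by positivity : (0 : ℝ) < U + 1)]
    calc |E U| / ((U : ℝ) + 1) ≤ B * Real.sqrt U / U := by
          refine div_le_div₀ (by positivity) (hEle U hU hUV) hU0 (by linarith)
      _ = B / Real.sqrt U := by
          rw [mul_div_assoc, Real.sqrt_div_self', mul_one_div]
  have hV1 : 1 ≤ V := hU.trans hUV
  have hV0 : (0 : ℝ) < V := by exact_mod_cast hV1
  have hEV : |E V / ((V : ℝ) + 1)| ≤ B / Real.sqrt U := by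
    rw [abs_div, abs_of_pos (by positivity : (0 : ℝ) < V + 1)]
    calc |E V| / ((V : ℝ) + 1) ≤ B * Real.sqrt V / V := by
          refine div_le_div₀ (by positivity) (hEle V hV1 le_rfl) hV0 (by linarith)
      _ = B / Real.sqrt V := by
          rw [mul_div_assoc, Real.sqrt_div_self', mul_one_div]
      _ ≤ B / Real.sqrt U :=
          div_le_div_of_nonneg_left hB hsU (Real.sqrt_le_sqrt (by exact_mod_cast hUV))
  have hEsum : |∑ n ∈ Ioc U V, E n * (1 / (n : ℝ) - 1 / ((n : ℝ) + 1))| ≤ 2 * B / Real.sqrt U := by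
    refine (Finset.abs_sum_le_sum_abs _ _).trans ?_
    have hterm : ∀ n ∈ Ioc U V, |E n * (1 / (n : ℝ) - 1 / ((n : ℝ) + 1))| ≤
        2 * B * (1 / Real.sqrt n - 1 / Real.sqrt ((n : ℝ) + 1)) := by
      intro n hn
      have hn1 : 1 ≤ n := by have := (Finset.mem_Ioc.mp hn).1; omega
      have hn0 : (0 : ℝ) < n := by exact_mod_cast hn1
      have hpos : 0 ≤ 1 / (n : ℝ) - 1 / ((n : ℝ) + 1) := by
        rw [sub_nonneg]; exact one_div_le_one_div_of_le hn0 (by linarith)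
      rw [abs_mul, abs_of_nonneg hpos]
      have hnV : n ≤ V := (Finset.mem_Ioc.mp hn).2
      calc |E n| * (1 / (n : ℝ) - 1 / ((n : ℝ) + 1))
          ≤ B * Real.sqrt n * (1 / (n : ℝ) - 1 / ((n : ℝ) + 1)) :=
            mul_le_mul_of_nonneg_right (hEle n hn1 hnV) hpos
        _ = B * (Real.sqrt n * (1 / (n : ℝ) - 1 / ((n : ℝ) + 1))) := by ring
        _ ≤ B * (2 * (1 / Real.sqrt n - 1 / Real.sqrt ((n : ℝ) + 1))) :=
            mul_le_mul_of_nonneg_left (sqrt_mul_inv_sub_inv_le hn1) hB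
        _ = _ := by ring
    refine (Finset.sum_le_sum hterm).trans ?_
    rw [← Finset.mul_sum, sum_Ioc_inv_sqrt_sub U hUV]
    have h1 : 1 / Real.sqrt ((U : ℝ) + 1) ≤ 1 / Real.sqrt U :=
      one_div_le_one_div_of_le hsU (Real.sqrt_le_sqrt (by linarith))
    have h2 : 0 ≤ 1 / Real.sqrt ((V : ℝ) + 1) := by positivity
    calc 2 * B * (1 / Real.sqrt ((U : ℝ) + 1) - 1 / Real.sqrt ((V : ℝ) + 1))
        ≤ 2 * B * (1 / Real.sqrt U) := by
          refine mul_le_mul_of_nonneg_left ?_ (by positivity); linarith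
      _ = 2 * B / Real.sqrt U := by ring
  -- assemble
  have hkey : ∑ n ∈ Ioc U V, (E n - E (n - 1)) / n =
      E V / ((V : ℝ) + 1) + ∑ n ∈ Ioc U V, E n * (1 / (n : ℝ) - 1 / ((n : ℝ) + 1)) -
        E U / ((U : ℝ) + 1) := by linarith [hAbel]
  rw [hsplit, hkey]
  have hc : |c * ∑ n ∈ Ioc U V, (1 : ℝ) / n - c * Real.log ((V : ℝ) / U)| ≤ 2 * |c| / U := by
    rw [← mul_sub, abs_mul]
    calc |c| * |∑ n ∈ Ioc U V, (1 : ℝ) / n - Real.log ((V : ℝ) / U)| ≤ |c| * (2 / U) :=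
          mul_le_mul_of_nonneg_left hmain (abs_nonneg c)
      _ = 2 * |c| / U := by ring
  calc |E V / ((V : ℝ) + 1) + ∑ n ∈ Ioc U V, E n * (1 / (n : ℝ) - 1 / ((n : ℝ) + 1)) -
          E U / ((U : ℝ) + 1) + c * ∑ n ∈ Ioc U V, (1 : ℝ) / n - c * Real.log ((V : ℝ) / U)|
      = |(E V / ((V : ℝ) + 1) + ∑ n ∈ Ioc U V, E n * (1 / (n : ℝ) - 1 / ((n : ℝ) + 1)) -
          E U / ((U : ℝ) + 1)) + (c * ∑ n ∈ Ioc U V, (1 : ℝ) / n - c * Real.log ((V : ℝ) / U))| := by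
        ring_nf
    _ ≤ |E V / ((V : ℝ) + 1) + ∑ n ∈ Ioc U V, E n * (1 / (n : ℝ) - 1 / ((n : ℝ) + 1)) -
          E U / ((U : ℝ) + 1)| + |c * ∑ n ∈ Ioc U V, (1 : ℝ) / n - c * Real.log ((V : ℝ) / U)| :=
        abs_add_le _ _
    _ ≤ (|E V / ((V : ℝ) + 1)| + |∑ n ∈ Ioc U V, E n * (1 / (n : ℝ) - 1 / ((n : ℝ) + 1))| +
          |E U / ((U : ℝ) + 1)|) + 2 * |c| / U := by
        refine add_le_add ?_ hc
        calc _ ≤ |E V / ((V : ℝ) + 1) + ∑ n ∈ Ioc U V, E n * (1 / (n : ℝ) - 1 / ((n : ℝ) + 1))| +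
              |E U / ((U : ℝ) + 1)| := abs_sub _ _
          _ ≤ _ := add_le_add (abs_add_le _ _) le_rfl
    _ ≤ (B / Real.sqrt U + 2 * B / Real.sqrt U + B / Real.sqrt U) + 2 * |c| / U := by
        gcongr
    _ = 2 * |c| / U + 4 * B / Real.sqrt U := by ring

/-! ### B. Logarithmic sums of `r = χ ∗ 1` over the multiples of a squarefree `d` -/

section CharDivisor

open Literature.NumberTheory.LFunctions

variable {N₀ : ℕ} [NeZero N₀] (χ : DirichletCharacter ℂ N₀)

/-- **Window sums of `r(n)/n` over the multiples of `d`**: for a quadratic character `χ ≠ χ₀`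
mod `N₀`, a squarefree `d` and `1 ≤ U ≤ V`,
`|∑_{U<n≤V, d∣n} r(n)/n − g_r(d) L(1,χ) log(V/U)| ≤ 2 |g_r(d) L(1,χ)|/U + 20 N₀ τ(d)²/(√d √U)`,
from the tree's level-of-distribution estimate `RealChar.abs_congrSum_charDivisorSum_sub_le`
(`|∑_{n ≤ x, d ∣ n} r(n) − g_r(d)L(1,χ)x| ≤ 5N₀√x τ(d)²/√d`) by partial summation
(`abs_logSum_sub_le`). [folklore] -/
theorem abs_logSum_charDivisorSum_sub_le (hχ : χ ≠ 1) (hq : χ ^ 2 = 1) {d : ℕ}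
    (hd : Squarefree d) {U V : ℕ} (hU : 1 ≤ U) (hUV : U ≤ V) :
    |∑ n ∈ (Ioc U V).filter (d ∣ ·), RealChar.charDivisorSum χ n / n -
        RealChar.charDivisorDensity χ d * (χ.LFunction 1).re * Real.log ((V : ℝ) / U)| ≤
      2 * |RealChar.charDivisorDensity χ d * (χ.LFunction 1).re| / U +
        4 * (5 * N₀ * (#d.divisors : ℝ) ^ 2 / Real.sqrt d) / Real.sqrt U := by
  set aa : ℕ → ℝ := fun n => if d ∣ n then RealChar.charDivisorSum χ n else 0 with haa
  have hA : ∀ N : ℕ, 1 ≤ N → |∑ n ∈ Ioc 0 N, aa n -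
      RealChar.charDivisorDensity χ d * (χ.LFunction 1).re * N| ≤
        5 * N₀ * (#d.divisors : ℝ) ^ 2 / Real.sqrt d * Real.sqrt N := by
    intro N hN
    have h := RealChar.abs_congrSum_charDivisorSum_sub_le χ hχ hq hd
      (x := (N : ℝ)) (by exact_mod_cast hN)
    rw [Nat.floor_natCast] at h
    rw [haa, ← Finset.sum_filter]
    rw [← mul_assoc] at h
    refine h.trans (le_of_eq ?_)
    ring
  have h := abs_logSum_sub_le (a := aa) (by positivity) (fun N hN _ => hA N hN) hU hUV
  have hsum : ∑ n ∈ (Ioc U V).filter (d ∣ ·), RealChar.charDivisorSum χ n / n =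
      ∑ n ∈ Ioc U V, aa n / n := by
    rw [Finset.sum_filter]
    refine Finset.sum_congr rfl fun n _ => ?_
    simp only [haa]
    split_ifs <;> simp
  rw [hsum]
  exact h

end CharDivisor

/-! ### C. The Möbius function on squares, `λ(d²) = μ(d)` -/

/-- `λ(n) = μ(d)` if `n = d²` is a perfect square and `0` otherwise: the Dirichlet inverse of the
indicator of the squares (`∑ λ(n) n^{-s} = 1/ζ(2s)`). [folklore] -/
def sqMoebius : ArithmeticFunction ℝ :=
  ⟨fun n => if Nat.sqrt n * Nat.sqrt n = n then (ArithmeticFunction.moebius (Nat.sqrt n) : ℝ)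
    else 0, by simp⟩

/-- Unfolding lemma. [folklore] -/
theorem sqMoebius_apply (n : ℕ) :
    sqMoebius n = if Nat.sqrt n * Nat.sqrt n = n then
      (ArithmeticFunction.moebius (Nat.sqrt n) : ℝ) else 0 := rfl

/-- `λ(d²) = μ(d)`. [folklore] -/
theorem sqMoebius_sq (d : ℕ) : sqMoebius (d * d) = ArithmeticFunction.moebius d := by
  rw [sqMoebius_apply, Nat.sqrt_eq, if_pos rfl]

/-- `|λ(n)| ≤ 1`. [folklore] -/
theorem abs_sqMoebius_le_one (n : ℕ) : |sqMoebius n| ≤ 1 := by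
  rw [sqMoebius_apply]
  split_ifs
  · exact_mod_cast ArithmeticFunction.abs_moebius_le_one
  · simp

/-- `λ(n) ≠ 0` forces `n = (√n)²`. [folklore] -/
theorem sqrt_mul_sqrt_of_sqMoebius_ne_zero {n : ℕ} (h : sqMoebius n ≠ 0) :
    Nat.sqrt n * Nat.sqrt n = n := by
  rw [sqMoebius_apply] at h
  by_contra h'
  exact h (if_neg h')

/-- For coprime `m, n`: if `mn` is a perfect square then so is `m`. [folklore] -/
theorem sqrt_mul_self_of_coprime_of_mul {m n : ℕ} (hmn : m.Coprime n)
    (h : Nat.sqrt (m * n) * Nat.sqrt (m * n) = m * n) : Nat.sqrt m * Nat.sqrt m = m := by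
  have hunit : IsUnit (gcd m n) := by
    have : gcd m n = 1 := hmn
    rw [this]; exact isUnit_one
  have hsq : m * n = Nat.sqrt (m * n) ^ 2 := by rw [pow_two]; exact h.symm
  obtain ⟨d, hd⟩ := exists_associated_pow_of_mul_eq_pow hunit hsq
  rw [associated_iff_eq] at hd
  rw [← hd, pow_two, Nat.sqrt_eq]

/-- `λ` is multiplicative. [folklore] -/
theorem isMultiplicative_sqMoebius : sqMoebius.IsMultiplicative := by
  rw [ArithmeticFunction.IsMultiplicative.iff_ne_zero]
  refine ⟨by rw [sqMoebius_apply]; simp, ?_⟩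
  intro m n hm hn hmn
  by_cases hms : Nat.sqrt m * Nat.sqrt m = m
  · by_cases hns : Nat.sqrt n * Nat.sqrt n = n
    · -- both squares
      set s := Nat.sqrt m
      set t := Nat.sqrt n
      have hst : m * n = (s * t) * (s * t) := by rw [← hms, ← hns]; ring
      have hcop : s.Coprime t := by
        have h1 : s ∣ m := ⟨s, hms.symm⟩
        have h2 : t ∣ n := ⟨t, hns.symm⟩
        exact (hmn.coprime_dvd_left h1).coprime_dvd_right h2
      conv_lhs => rw [hst, sqMoebius_sq]
      conv_rhs => rw [← hms, ← hns, sqMoebius_sq, sqMoebius_sq]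
      rw [ArithmeticFunction.isMultiplicative_moebius.map_mul_of_coprime hcop]
      push_cast; ring
    · -- `n` not a square ⇒ `mn` not a square
      have hmn' : ¬ Nat.sqrt (m * n) * Nat.sqrt (m * n) = m * n := fun h =>
        hns (sqrt_mul_self_of_coprime_of_mul hmn.symm (by rwa [mul_comm n m]))
      rw [sqMoebius_apply, if_neg hmn', sqMoebius_apply n, if_neg hns, mul_zero]
  · have hmn' : ¬ Nat.sqrt (m * n) * Nat.sqrt (m * n) = m * n := fun h =>
      hms (sqrt_mul_self_of_coprime_of_mul hmn h)
    rw [sqMoebius_apply, if_neg hmn', sqMoebius_apply m, if_neg hms, zero_mul]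

/-- `λ(1) = 1`. [folklore] -/
theorem sqMoebius_one : sqMoebius 1 = 1 := isMultiplicative_sqMoebius.map_one

/-- `λ(p) = 0` at a prime. [folklore] -/
theorem sqMoebius_prime {p : ℕ} (hp : p.Prime) : sqMoebius p = 0 := by
  rw [sqMoebius_apply, if_neg]
  intro h
  have hdvd : Nat.sqrt p ∣ p := ⟨Nat.sqrt p, h.symm⟩
  rcases (Nat.dvd_prime hp).mp hdvd with h1 | h1
  · rw [h1, one_mul] at h
    exact hp.one_lt.ne h
  · rw [h1] at h
    have h2 : p * p = p * 1 := by rw [h, mul_one]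
    have : p = 1 := Nat.eq_of_mul_eq_mul_left hp.pos h2
    exact hp.one_lt.ne' this

/-- `λ(p²) = −1` at a prime. [folklore] -/
theorem sqMoebius_prime_sq {p : ℕ} (hp : p.Prime) : sqMoebius (p ^ 2) = -1 := by
  rw [pow_two, sqMoebius_sq, ArithmeticFunction.moebius_apply_prime hp]; norm_num

/-- `λ(p^j) = 0` for a prime `p` and `j ≥ 3`. [folklore] -/
theorem sqMoebius_prime_pow_eq_zero {p : ℕ} (hp : p.Prime) {j : ℕ} (hj : 3 ≤ j) :
    sqMoebius (p ^ j) = 0 := by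
  rw [sqMoebius_apply]
  split_ifs with h
  · set s := Nat.sqrt (p ^ j)
    have hdvd : s ∣ p ^ j := ⟨s, h.symm⟩
    obtain ⟨k, hk, hks⟩ := (Nat.dvd_prime_pow hp).mp hdvd
    have h2k : p ^ (2 * k) = p ^ j := by rw [two_mul, pow_add, ← hks]; exact h
    have hjk : 2 * k = j := Nat.pow_right_injective hp.two_le h2k
    have hk2 : k ≠ 1 := by omega
    have hk0 : k ≠ 0 := by omega
    rw [hks, ArithmeticFunction.moebius_apply_prime_pow hp hk0, if_neg hk2]
    simp
  · rfl

/-- **`(λ ∗ R)(p^i)` at a prime power**, `i ≥ 2`: `= R(p^i) − R(p^{i−2})`. [folklore] -/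
theorem sqMoebius_mul_apply_prime_pow (R : ArithmeticFunction ℝ) {p : ℕ} (hp : p.Prime)
    {i : ℕ} (hi : 2 ≤ i) :
    (sqMoebius * R) (p ^ i) = R (p ^ i) - R (p ^ (i - 2)) := by
  rw [ArithmeticFunction.mul_apply, Nat.sum_divisorsAntidiagonal (fun x y => sqMoebius x * R y),
    Nat.divisors_prime_pow hp, Finset.sum_map]
  simp only [Function.Embedding.coeFn_mk]
  obtain ⟨i', rfl⟩ : ∃ i', i = i' + 2 := ⟨i - 2, by omega⟩
  rw [Nat.add_sub_cancel]
  -- the terms `j ≥ 3` vanish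
  have hsplit : Finset.range (i' + 2 + 1) = Finset.range 3 ∪ Finset.Ico 3 (i' + 3) := by
    rw [Finset.range_eq_Ico, Finset.range_eq_Ico, show i' + 2 + 1 = i' + 3 by ring,
      Finset.Ico_union_Ico_eq_Ico (by omega) (by omega)]
  have hdisj : Disjoint (Finset.range 3) (Finset.Ico 3 (i' + 3)) := by
    rw [Finset.range_eq_Ico]; exact Finset.Ico_disjoint_Ico_consecutive 0 3 (i' + 3)
  rw [hsplit, Finset.sum_union hdisj]
  have htail : ∑ j ∈ Finset.Ico 3 (i' + 3), sqMoebius (p ^ j) * R (p ^ (i' + 2) / p ^ j) = 0 := by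
    refine Finset.sum_eq_zero fun j hj => ?_
    rw [Finset.mem_Ico] at hj
    rw [sqMoebius_prime_pow_eq_zero hp hj.1, zero_mul]
  rw [htail, add_zero, Finset.sum_range_succ, Finset.sum_range_succ, Finset.sum_range_one,
    pow_zero, Nat.div_one, sqMoebius_one, one_mul, pow_one, sqMoebius_prime hp, zero_mul,
    add_zero, sqMoebius_prime_sq hp, Nat.pow_div (by omega) hp.pos, Nat.add_sub_cancel]
  ring

/-- `(λ ∗ R)(p) = R(p)`. [folklore] -/
theorem sqMoebius_mul_apply_prime (R : ArithmeticFunction ℝ) {p : ℕ} (hp : p.Prime) :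
    (sqMoebius * R) p = R p := by
  rw [ArithmeticFunction.mul_apply, Nat.sum_divisorsAntidiagonal (fun x y => sqMoebius x * R y),
    hp.divisors, Finset.sum_pair hp.one_lt.ne, Nat.div_one, sqMoebius_one, one_mul,
    sqMoebius_prime hp, zero_mul, add_zero]

/-! ### D. The quadratic `G = aX² + bX + c`: irreducibility, the character `χ_Δ`, non-principality -/

section Quadratic

open Polynomial Iwaniec1978
open scoped NumberTheorySymbols

variable {a b c : ℤ}

/-- **Irreducibility criterion**: a primitive quadratic `aX² + bX + c ∈ ℤ[X]` (`a ≠ 0`) with no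
rational root is irreducible in `ℤ[X]` (Gauss's lemma and "degree `≤ 3` without roots").
[folklore] -/
theorem irreducible_quadPoly_of_forall_ne_zero (ha : a ≠ 0) (hprim : Int.gcd (Int.gcd a b) c = 1)
    (hroot : ∀ x : ℚ, (a : ℚ) * x ^ 2 + b * x + c ≠ 0) : Irreducible (quadPoly a b c) := by
  have hP : (quadPoly a b c).IsPrimitive := by
    intro r hr
    rw [Polynomial.C_dvd_iff_dvd_coeff] at hr
    have h2 := hr 2
    have h1 := hr 1
    have h0 := hr 0
    simp only [quadPoly, coeff_add, coeff_C_mul, coeff_X_pow, coeff_X, coeff_C] at h2 h1 h0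
    norm_num at h2 h1 h0
    have hg : r ∣ (Int.gcd (Int.gcd a b) c : ℤ) :=
      Int.dvd_coe_gcd (Int.dvd_coe_gcd h2 h1) h0
    rw [hprim] at hg
    exact isUnit_of_dvd_one (by exact_mod_cast hg)
  rw [hP.irreducible_iff_irreducible_map_fraction_map (K := ℚ)]
  have hmap : (quadPoly a b c).map (algebraMap ℤ ℚ) =
      C (a : ℚ) * X ^ 2 + C (b : ℚ) * X + C (c : ℚ) := by
    simp [quadPoly, Polynomial.map_add, Polynomial.map_mul]
  rw [hmap]
  refine Polynomial.irreducible_of_degree_le_three_of_not_isRoot ?_ fun x hx => ?_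
  · rw [natDegree_quadratic (by exact_mod_cast ha)]; decide
  · refine hroot x ?_
    have := hx
    simp only [IsRoot.def, eval_add, eval_mul, eval_C, eval_pow, eval_X] at this
    exact this

/-- Conversely an irreducible quadratic (`a ≠ 0`) has no rational root. [folklore] -/
theorem forall_ne_zero_of_irreducible (ha : a ≠ 0) (hirr : Irreducible (quadPoly a b c)) (x : ℚ) :
    (a : ℚ) * x ^ 2 + b * x + c ≠ 0 := by
  intro hx
  have hP : (quadPoly a b c).IsPrimitive :=
    hirr.isPrimitive (by rw [natDegree_quadPoly ha]; decide)
  have hirr' := (hP.irreducible_iff_irreducible_map_fraction_map (K := ℚ)).mp hirr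
  have hmap : (quadPoly a b c).map (algebraMap ℤ ℚ) =
      C (a : ℚ) * X ^ 2 + C (b : ℚ) * X + C (c : ℚ) := by
    simp [quadPoly, Polynomial.map_add, Polynomial.map_mul]
  rw [hmap] at hirr'
  have hdeg : (C (a : ℚ) * X ^ 2 + C (b : ℚ) * X + C (c : ℚ)).natDegree = 2 :=
    natDegree_quadratic (by exact_mod_cast ha)
  have hroots := (Polynomial.irreducible_iff_roots_eq_zero_of_degree_le_three
    (by rw [hdeg]) (by rw [hdeg]; norm_num)).mp hirr'
  have hne : C (a : ℚ) * X ^ 2 + C (b : ℚ) * X + C (c : ℚ) ≠ 0 :=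
    ne_zero_of_natDegree_gt (n := 1) (by rw [hdeg]; norm_num)
  have hmem : x ∈ (C (a : ℚ) * X ^ 2 + C (b : ℚ) * X + C (c : ℚ)).roots := by
    rw [mem_roots hne]
    simp [hx]
  rw [hroots] at hmem
  simp at hmem

/-- **Non-principality witness for the Kronecker symbol of the discriminant, odd constant term**:
for `G = aX² + bX + c` irreducible with `a > 0` and `c` odd there is an odd `n` with
`(Δ/n) = −1`, `Δ = b² − 4ac` (from the tree's `ne_one_of_forall_odd`). [folklore] -/
theorem exists_odd_jacobiSym_eq_neg_one_of_odd (ha : 0 < a) (hc : Odd c)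
    (hirr : Irreducible (quadPoly a b c)) : ∃ n : ℕ, Odd n ∧ J(b ^ 2 - 4 * a * c | n) = -1 := by
  have hΔ0 : b ^ 2 - 4 * a * c ≠ 0 := disc_ne_zero ha.ne' hirr
  set N : ℕ := 4 * (b ^ 2 - 4 * a * c).natAbs with hN
  obtain ⟨χ, hχ⟩ := QuadraticFields.exists_dirichletCharacter_four_mul _ hΔ0
  haveI : NeZero N := ⟨mul_ne_zero (by norm_num) (Int.natAbs_ne_zero.mpr hΔ0)⟩
  have hne := Iwaniec1978.ne_one_of_forall_odd ha hc hirr hχ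
  obtain ⟨u, hu⟩ := MulChar.ne_one_iff.mp hne
  set n : ℕ := (u : ZMod N).val with hn
  have hcop : n.Coprime N := ZMod.val_coe_unit_coprime u
  have h2 : n.Coprime 2 :=
    Nat.Coprime.coprime_dvd_right (show 2 ∣ N from ⟨2 * (b ^ 2 - 4 * a * c).natAbs, by
      rw [hN]; ring⟩) hcop
  have hodd : Odd n := Nat.coprime_two_right.mp h2
  refine ⟨n, hodd, ?_⟩
  have hval : χ (n : ZMod N) = χ u := by rw [hn, ZMod.natCast_zmod_val]
  have hJne : (J(b ^ 2 - 4 * a * c | n) : ℂ) ≠ 1 := by rw [← hχ n hodd, hval]; exact hu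
  have hn0 : n ≠ 0 := by
    intro h0
    rw [h0, Nat.coprime_zero_left] at hcop
    have : 4 ≤ N := by
      rw [hN]; have := Int.natAbs_pos.mpr hΔ0; omega
    omega
  haveI : NeZero n := ⟨hn0⟩
  have hJ0 : J(b ^ 2 - 4 * a * c | n) ≠ 0 := by
    rw [Ne, jacobiSym.eq_zero_iff_not_coprime, not_not]
    have hcop' : n.Coprime (b ^ 2 - 4 * a * c).natAbs :=
      Nat.Coprime.coprime_mul_left_right (by rw [hN] at hcop; exact hcop)
    rw [Int.gcd_eq_natAbs, Int.natAbs_natCast]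
    exact hcop'.symm
  rcases jacobiSym.trichotomy (b ^ 2 - 4 * a * c) n with h | h | h
  · exact absurd h hJ0
  · exfalso; apply hJne; rw [h]; simp
  · exact h

/-- From `gcd(a, b, c) = 1`: a common divisor of `a, b, c` divides `1`. [folklore] -/
theorem dvd_one_of_gcd_eq_one (hprim : Int.gcd (Int.gcd a b) c = 1) {d : ℤ} (h1 : d ∣ a)
    (h2 : d ∣ b) (h3 : d ∣ c) : d ∣ 1 := by
  have := Int.dvd_coe_gcd (Int.dvd_coe_gcd h1 h2) h3
  rwa [hprim] at this

/-- Conversely, if every common divisor of `x, y, z` divides `1` then `gcd(x, y, z) = 1`.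
[folklore] -/
theorem gcd_eq_one_of_forall_dvd {x y z : ℤ} (h : ∀ d : ℤ, d ∣ x → d ∣ y → d ∣ z → d ∣ 1) :
    Int.gcd (Int.gcd x y) z = 1 := by
  have hg := h _ ((Int.gcd_dvd_left _ _).trans (Int.gcd_dvd_left _ _))
    ((Int.gcd_dvd_left _ _).trans (Int.gcd_dvd_right _ _)) (Int.gcd_dvd_right _ _)
  exact_mod_cast Int.eq_one_of_dvd_one (by positivity) hg

/-- **Non-principality witness, general case**: for `G = aX² + bX + c` irreducible with `a > 0`
there is an odd `n` with `(Δ/n) = −1` — reduce to an odd constant term by passing to the reversed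
polynomial `±(cX² + bX + a)` (`c` odd... i.e. when `a` is odd) or to `G(X+1) = aX² + (2a+b)X +
(a+b+c)` (when `a`, `c` are even, so `b` is odd); all three have discriminant `Δ`. [folklore] -/
theorem exists_odd_jacobiSym_eq_neg_one (ha : 0 < a) (hirr : Irreducible (quadPoly a b c)) :
    ∃ n : ℕ, Odd n ∧ J(b ^ 2 - 4 * a * c | n) = -1 := by
  have hprim := gcd_coeffs_eq_one ha.ne' hirr
  have hroot := forall_ne_zero_of_irreducible ha.ne' hirr
  have hc0 : c ≠ 0 := by
    intro h0
    have := hroot 0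
    simp [h0] at this
  rcases Int.even_or_odd c with hce | hco
  · rcases Int.even_or_odd a with hae | hao
    · -- `a`, `c` even: `G(X + 1)`
      have hb : Odd b := by
        by_contra hb
        rw [Int.not_odd_iff_even] at hb
        obtain ⟨a', ha'⟩ := hae
        obtain ⟨b', hb'⟩ := hb
        obtain ⟨c', hc'⟩ := hce
        have h2 : (2 : ℤ) ∣ (Int.gcd (Int.gcd a b) c : ℤ) :=
          Int.dvd_coe_gcd (Int.dvd_coe_gcd ⟨a', by rw [ha']; ring⟩ ⟨b', by rw [hb']; ring⟩)
            ⟨c', by rw [hc']; ring⟩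
        rw [hprim] at h2
        norm_num at h2
      have hirr' : Irreducible (quadPoly a (2 * a + b) (a + b + c)) := by
        refine irreducible_quadPoly_of_forall_ne_zero ha.ne' ?_ fun x hx => ?_
        · -- primitivity
          refine gcd_eq_one_of_forall_dvd fun d h1 h2 h3 => dvd_one_of_gcd_eq_one hprim h1 ?_ ?_
          · have : b = (2 * a + b) - 2 * a := by ring
            rw [this]; exact dvd_sub h2 (h1.mul_left 2)
          · have hb' : d ∣ b := by
              have : b = (2 * a + b) - 2 * a := by ring
              rw [this]; exact dvd_sub h2 (h1.mul_left 2)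
            have : c = (a + b + c) - a - b := by ring
            rw [this]; exact dvd_sub (dvd_sub h3 h1) hb'
        · refine hroot (x + 1) ?_
          push_cast at hx
          linear_combination hx
      obtain ⟨n, hn, hJ⟩ := exists_odd_jacobiSym_eq_neg_one_of_odd ha
        (by
          obtain ⟨a', ha'⟩ := hae
          obtain ⟨c', hc'⟩ := hce
          obtain ⟨b', hb'⟩ := hb
          exact ⟨a' + b' + c', by rw [ha', hb', hc']; ring⟩) hirr'
      refine ⟨n, hn, ?_⟩
      have : (2 * a + b) ^ 2 - 4 * a * (a + b + c) = b ^ 2 - 4 * a * c := by ring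
      rwa [this] at hJ
    · -- `a` odd, `c` even: the reversed polynomial, with positive leading coefficient
      have hrev : ∀ x : ℚ, (c : ℚ) * x ^ 2 + b * x + a ≠ 0 := by
        intro x hx
        have hx0 : x ≠ 0 := by
          rintro rfl
          simp at hx
          exact ha.ne' (by exact_mod_cast hx)
        refine hroot x⁻¹ ?_
        field_simp
        linear_combination hx
      rcases lt_or_gt_of_ne hc0 with hneg | hpos
      · have hirr' : Irreducible (quadPoly (-c) (-b) (-a)) := by
          refine irreducible_quadPoly_of_forall_ne_zero (by omega) ?_ fun x hx => ?_
          · exact gcd_eq_one_of_forall_dvd fun d h1 h2 h3 =>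
              dvd_one_of_gcd_eq_one hprim (dvd_neg.mp h3) (dvd_neg.mp h2) (dvd_neg.mp h1)
          · refine hrev x ?_
            push_cast at hx
            linear_combination -hx
        obtain ⟨n, hn, hJ⟩ := exists_odd_jacobiSym_eq_neg_one_of_odd (by omega) hao.neg hirr'
        refine ⟨n, hn, ?_⟩
        have : (-b) ^ 2 - 4 * -c * -a = b ^ 2 - 4 * a * c := by ring
        rwa [this] at hJ
      · have hirr' : Irreducible (quadPoly c b a) := by
          refine irreducible_quadPoly_of_forall_ne_zero hc0 ?_ hrev
          exact gcd_eq_one_of_forall_dvd fun d h1 h2 h3 => dvd_one_of_gcd_eq_one hprim h3 h2 h1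
        obtain ⟨n, hn, hJ⟩ := exists_odd_jacobiSym_eq_neg_one_of_odd hpos hao hirr'
        refine ⟨n, hn, ?_⟩
        have : b ^ 2 - 4 * c * a = b ^ 2 - 4 * a * c := by ring
        rwa [this] at hJ
  · exact exists_odd_jacobiSym_eq_neg_one_of_odd ha hco hirr

variable {χ : DirichletCharacter ℂ (4 * (b ^ 2 - 4 * a * c).natAbs)}

/-- **`χ_Δ` is non-principal** for every irreducible `G` with `a > 0` (no parity hypothesis on
`c`). [folklore] -/
theorem chi_ne_one (ha : 0 < a) (hirr : Irreducible (quadPoly a b c))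
    (hχ : ∀ n : ℕ, Odd n → χ n = (J(b ^ 2 - 4 * a * c | n) : ℂ)) : χ ≠ 1 := by
  obtain ⟨n, hn, hJ⟩ := exists_odd_jacobiSym_eq_neg_one ha hirr
  intro h1
  have h := hχ n hn
  rw [h1, hJ] at h
  have hΔ0 : b ^ 2 - 4 * a * c ≠ 0 := disc_ne_zero ha.ne' hirr
  haveI : NeZero (4 * (b ^ 2 - 4 * a * c).natAbs) :=
    ⟨mul_ne_zero (by norm_num) (Int.natAbs_ne_zero.mpr hΔ0)⟩
  -- `1 n ∈ {0, 1}`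
  rcases MulChar.isQuadratic_iff_sq_eq_one.mpr (one_pow 2 : (1 : DirichletCharacter ℂ
      (4 * (b ^ 2 - 4 * a * c).natAbs)) ^ 2 = 1) (n : ZMod _) with h0 | h0 | h0
  · rw [h0] at h; norm_num at h
  · rw [h0] at h; norm_num at h
  · -- `1 x = -1` is impossible
    have : (1 : DirichletCharacter ℂ (4 * (b ^ 2 - 4 * a * c).natAbs)) (n : ZMod _) ≠ -1 := by
      by_cases hu : IsUnit ((n : ℕ) : ZMod (4 * (b ^ 2 - 4 * a * c).natAbs))
      · rw [MulChar.one_apply hu]; norm_num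
      · rw [MulChar.map_nonunit _ hu]; norm_num
    exact this h0

/-- `χ_Δ` is quadratic: `χ² = 1`. [folklore] -/
theorem chi_sq_eq_one (hΔ0 : b ^ 2 - 4 * a * c ≠ 0)
    (hχ : ∀ n : ℕ, Odd n → χ n = (J(b ^ 2 - 4 * a * c | n) : ℂ)) : χ ^ 2 = 1 :=
  MulChar.isQuadratic_iff_sq_eq_one.mp (QuadraticFields.isQuadratic_of_forall_odd hΔ0 hχ)

/-- The values of `χ_Δ` at the primes not dividing `2Δ` are `±1`:
`reChar χ p = (Δ/p) ∈ {1, −1}`. [folklore] -/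
theorem reChar_prime_eq_or (hχ : ∀ n : ℕ, Odd n → χ n = (J(b ^ 2 - 4 * a * c | n) : ℂ))
    {p : ℕ} (hp : p.Prime) (hp2 : p ≠ 2) (hpΔ : ¬ (p : ℤ) ∣ b ^ 2 - 4 * a * c) :
    LFunctions.DirichletAbel.reChar χ p = 1 ∨ LFunctions.DirichletAbel.reChar χ p = -1 := by
  rw [LFunctions.DirichletAbel.reChar_apply χ hp.ne_zero, re_apply_prime_eq_jacobiSym hχ hp hp2]
  haveI : NeZero p := ⟨hp.ne_zero⟩
  have hJ0 : J(b ^ 2 - 4 * a * c | p) ≠ 0 := by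
    rw [Ne, jacobiSym.eq_zero_iff_not_coprime, not_not, Int.gcd_eq_natAbs, Int.natAbs_natCast]
    exact Nat.Coprime.symm ((Nat.Prime.coprime_iff_not_dvd hp).mpr fun h =>
      hpΔ (Int.natCast_dvd.mpr h))
  rcases jacobiSym.trichotomy (b ^ 2 - 4 * a * c) p with h | h | h
  · exact absurd h hJ0
  · left; rw [h]; simp
  · right; rw [h]; simp

end Quadratic

/-! ### E. `ρ_G = λ ∗ r` on the integers prime to the bad modulus `Q` -/

section RhoIdentity

open Polynomial Iwaniec1978 ArithmeticFunction
open scoped NumberTheorySymbols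
open Literature.NumberTheory.LFunctions (DirichletAbel.reChar DirichletAbel.reChar_apply
  RealChar.charDivisorSum RealChar.charDivisorSum_prime RealChar.charDivisorSum_prime_pow
  RealChar.isMultiplicative_charDivisorSum)

/-- Restriction of an arithmetic function to the integers prime to `Q` (extended by `0`).
[folklore] -/
def restrictCoprime (Q : ℕ) (f : ArithmeticFunction ℝ) : ArithmeticFunction ℝ :=
  ⟨fun n => if n.Coprime Q then f n else 0, by
    by_cases h : (0 : ℕ).Coprime Q <;> simp [h]⟩

/-- Unfolding lemma. [folklore] -/
theorem restrictCoprime_apply (Q : ℕ) (f : ArithmeticFunction ℝ) (n : ℕ) :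
    restrictCoprime Q f n = if n.Coprime Q then f n else 0 := rfl

/-- The restriction of a multiplicative function to the integers prime to `Q` is
multiplicative. [folklore] -/
theorem isMultiplicative_restrictCoprime (Q : ℕ) {f : ArithmeticFunction ℝ}
    (hf : f.IsMultiplicative) : (restrictCoprime Q f).IsMultiplicative := by
  refine ⟨by rw [restrictCoprime_apply, if_pos (Nat.coprime_one_left Q), hf.map_one], ?_⟩
  intro m n hmn
  rw [restrictCoprime_apply, restrictCoprime_apply, restrictCoprime_apply]
  by_cases hm : m.Coprime Q
  · by_cases hn : n.Coprime Q
    · rw [if_pos (Nat.Coprime.mul_left hm hn), if_pos hm, if_pos hn, hf.map_mul_of_coprime hmn]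
    · have : ¬ (m * n).Coprime Q := fun h => hn (Nat.Coprime.coprime_mul_left h)
      rw [if_neg this, if_neg hn, mul_zero]
  · have : ¬ (m * n).Coprime Q := fun h => hm (Nat.Coprime.coprime_mul_right h)
    rw [if_neg this, if_neg hm, zero_mul]

variable {a b c : ℤ} {Q : ℕ}
variable {χ : DirichletCharacter ℂ (4 * (b ^ 2 - 4 * a * c).natAbs)}

/-- `ρ_G` as a real arithmetic function (a local copy of the tree's `Iwaniec1978.rhoGArith`,
which lives in a heavier file). [folklore] -/
def rhoArith (a b c : ℤ) : ArithmeticFunction ℝ :=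
  ⟨fun n => (rhoG a b c n : ℝ), by simp [rhoG, polyRootCountMod]⟩

/-- `rhoArith n = ρ_G(n)`. [folklore] -/
@[simp] theorem rhoArith_apply (n : ℕ) : rhoArith a b c n = (rhoG a b c n : ℝ) := rfl

/-- `ρ_G(1) = 1`. [folklore] -/
theorem rhoG_one' (a b c : ℤ) : rhoG a b c 1 = 1 := by
  simp [rhoG, polyRootCountMod]

/-- `ρ_G` is multiplicative (Chinese remainder theorem, the tree's
`polyRootCountMod_mul_of_coprime`). [folklore] -/
theorem isMultiplicative_rhoArith : (rhoArith a b c).IsMultiplicative := by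
  refine ⟨by simp [rhoG_one'], fun {m n} h => ?_⟩
  simp only [rhoArith_apply]
  unfold rhoG
  exact_mod_cast polyRootCountMod_mul_of_coprime (quadPoly a b c) h

/-- **`ρ_G(p) = 1 + χ_Δ(p)` at the good primes**: for a prime `p ∤ Q`, where the bad modulus
`Q` is divisible by `2` and by the primes dividing `a`. [folklore] -/
theorem rhoG_prime_eq_one_add_reChar (ha : 0 < a) (hirr : Irreducible (quadPoly a b c))
    (hχ : ∀ n : ℕ, Odd n → χ n = (J(b ^ 2 - 4 * a * c | n) : ℂ))
    (hQ2 : 2 ∣ Q) (hQa : ∀ p : ℕ, p.Prime → (p : ℤ) ∣ a → p ∣ Q)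
    {p : ℕ} (hp : p.Prime) (hpQ : ¬ p ∣ Q) :
    (rhoG a b c p : ℝ) = 1 + DirichletAbel.reChar χ p := by
  have hp2 : p ≠ 2 := fun h => hpQ (h ▸ hQ2)
  have hpa : ¬ (p : ℤ) ∣ a := fun h => hpQ (hQa p hp h)
  rw [DirichletAbel.reChar_apply χ hp.ne_zero]
  exact rhoG_eq_one_add_re ha hirr hχ hp hp2 hpa

/-- At a good prime `χ_Δ(p) = ±1` (the bad modulus is also divisible by the primes dividing
`Δ`). [folklore] -/
theorem reChar_good_prime (hχ : ∀ n : ℕ, Odd n → χ n = (J(b ^ 2 - 4 * a * c | n) : ℂ))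
    (hQ2 : 2 ∣ Q) (hQΔ : ∀ p : ℕ, p.Prime → (p : ℤ) ∣ b ^ 2 - 4 * a * c → p ∣ Q)
    {p : ℕ} (hp : p.Prime) (hpQ : ¬ p ∣ Q) :
    DirichletAbel.reChar χ p = 1 ∨ DirichletAbel.reChar χ p = -1 :=
  reChar_prime_eq_or hχ hp (fun h => hpQ (h ▸ hQ2)) fun h => hpQ (hQΔ p hp h)

/-- **The identity `ρ_G = λ ∗ r` on the integers prime to `Q`** (`r = χ_Δ ∗ 1`,
`λ = sqMoebius`), i.e. `ρ_G(m) = ∑_{d² ∣ m} μ(d) r(m/d²)` for `(m, Q) = 1`.  Hypotheses on the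
bad modulus `Q`: `2 ∣ Q`, the primes dividing `a` and `Δ` divide `Q`, and `ρ_G(p^k) = ρ_G(p)`
for `k ≥ 1` and `p ∤ Q` (Hensel).  Both sides are multiplicative, and at a good prime power
`p^i` both equal `1 + χ(p)`: `r(p^i) − r(p^{i−2}) = χ(p)^{i−1} + χ(p)^i = 1 + χ(p)` as
`χ(p) = ±1`. [folklore] -/
theorem rhoG_eq_sqMoebius_mul_charDivisorSum (ha : 0 < a) (hirr : Irreducible (quadPoly a b c))
    (hχ : ∀ n : ℕ, Odd n → χ n = (J(b ^ 2 - 4 * a * c | n) : ℂ))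
    (hQ2 : 2 ∣ Q) (hQa : ∀ p : ℕ, p.Prime → (p : ℤ) ∣ a → p ∣ Q)
    (hQΔ : ∀ p : ℕ, p.Prime → (p : ℤ) ∣ b ^ 2 - 4 * a * c → p ∣ Q)
    (hpow : ∀ p : ℕ, p.Prime → ¬ p ∣ Q → ∀ k : ℕ, 1 ≤ k → rhoG a b c (p ^ k) = rhoG a b c p)
    {m : ℕ} (hm : m.Coprime Q) :
    (rhoG a b c m : ℝ) = (sqMoebius * RealChar.charDivisorSum χ) m := by
  have hΔ0 : b ^ 2 - 4 * a * c ≠ 0 := disc_ne_zero ha.ne' hirr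
  have hq : χ ^ 2 = 1 := chi_sq_eq_one hΔ0 hχ
  set F := restrictCoprime Q (rhoArith a b c) with hF
  set G := restrictCoprime Q (sqMoebius * RealChar.charDivisorSum χ) with hG
  have hFm : F.IsMultiplicative := isMultiplicative_restrictCoprime Q isMultiplicative_rhoArith
  have hGm : G.IsMultiplicative := isMultiplicative_restrictCoprime Q
    (isMultiplicative_sqMoebius.mul (RealChar.isMultiplicative_charDivisorSum χ hq))
  suffices hFG : F = G by
    have h := congrArg (fun f : ArithmeticFunction ℝ => f m) hFG
    simp only [hF, hG, restrictCoprime_apply, if_pos hm, rhoArith_apply] at h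
    exact h
  rw [ArithmeticFunction.IsMultiplicative.eq_iff_eq_on_prime_powers F hFm G hGm]
  intro p i hp
  rcases Nat.eq_zero_or_pos i with rfl | hi
  · rw [pow_zero, hFm.map_one, hGm.map_one]
  simp only [hF, hG, restrictCoprime_apply]
  by_cases hpQ : p ∣ Q
  · have hnc : ¬ (p ^ i).Coprime Q := fun h =>
      (Nat.Prime.coprime_iff_not_dvd hp).mp ((Nat.coprime_pow_left_iff hi p Q).mp h) hpQ
    rw [if_neg hnc, if_neg hnc]
  · have hc : (p ^ i).Coprime Q := Nat.Coprime.pow_left i ((Nat.Prime.coprime_iff_not_dvd hp).mpr hpQ)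
    rw [if_pos hc, if_pos hc, rhoArith_apply, hpow p hp hpQ i hi,
      rhoG_prime_eq_one_add_reChar ha hirr hχ hQ2 hQa hp hpQ]
    set x := DirichletAbel.reChar χ p with hx
    rcases Nat.lt_or_ge i 2 with hi1 | hi2
    · have hi1' : i = 1 := by omega
      rw [hi1', pow_one, sqMoebius_mul_apply_prime _ hp, RealChar.charDivisorSum_prime χ hq hp]
    · rw [sqMoebius_mul_apply_prime_pow _ hp hi2]
      obtain ⟨j, rfl⟩ : ∃ j, i = j + 2 := ⟨i - 2, by omega⟩
      rw [Nat.add_sub_cancel, RealChar.charDivisorSum_prime_pow χ hq hp,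
        RealChar.charDivisorSum_prime_pow χ hq hp, Finset.sum_range_succ, Finset.sum_range_succ,
        ← hx]
      have hsum : ∑ k ∈ Finset.range (j + 1), x ^ k + x ^ (j + 1) + x ^ (j + 1 + 1) -
          ∑ k ∈ Finset.range (j + 1), x ^ k = x ^ (j + 1) * (1 + x) := by ring
      rw [hsum]
      rcases reChar_good_prime hχ hQ2 hQΔ hp hpQ with h1 | h1 <;> rw [← hx] at h1 <;> rw [h1] <;>
        norm_num

/-- `ρ_G(n) ≤ τ(n)` for `(n, Q) = 1` (at the good primes `ρ_G(p^k) = ρ_G(p) ≤ 2 ≤ k + 1`).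
[folklore] -/
theorem rhoG_le_card_divisors (ha : 0 < a) (hirr : Irreducible (quadPoly a b c))
    (hχ : ∀ n : ℕ, Odd n → χ n = (J(b ^ 2 - 4 * a * c | n) : ℂ))
    (hQ2 : 2 ∣ Q) (hQa : ∀ p : ℕ, p.Prime → (p : ℤ) ∣ a → p ∣ Q)
    (hpow : ∀ p : ℕ, p.Prime → ¬ p ∣ Q → ∀ k : ℕ, 1 ≤ k → rhoG a b c (p ^ k) = rhoG a b c p)
    {n : ℕ} (hn : n.Coprime Q) (hn0 : n ≠ 0) : rhoG a b c n ≤ n.divisors.card := by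
  have hmult := (isMultiplicative_rhoArith (a := a) (b := b) (c := c)).multiplicative_factorization
    (rhoArith a b c) hn0
  rw [rhoArith_apply] at hmult
  rw [Nat.card_divisors hn0]
  have hcast : (rhoG a b c n : ℝ) = n.factorization.prod fun p k => (rhoG a b c (p ^ k) : ℝ) := by
    rw [hmult]; rfl
  have hle : (n.factorization.prod fun p k => (rhoG a b c (p ^ k) : ℝ)) ≤
      n.factorization.prod fun p k => ((k + 1 : ℕ) : ℝ) := by
    unfold Finsupp.prod
    refine Finset.prod_le_prod (fun p _ => Nat.cast_nonneg _) fun p hp => ?_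
    have hp' := Nat.prime_of_mem_primeFactors (Nat.support_factorization n ▸ hp)
    have hk : 1 ≤ n.factorization p := Nat.pos_of_ne_zero (Finsupp.mem_support_iff.mp hp)
    have hpQ : ¬ p ∣ Q := fun h => by
      have hpn : p ∣ n := Nat.dvd_of_mem_primeFactors (Nat.support_factorization n ▸ hp)
      exact (Nat.Prime.coprime_iff_not_dvd hp').mp ((Nat.coprime_comm.mp hn).symm |>
        fun h' => Nat.Coprime.coprime_dvd_left hpn hn) h
    show (rhoG a b c (p ^ n.factorization p) : ℝ) ≤ ((n.factorization p + 1 : ℕ) : ℝ)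
    rw [hpow p hp' hpQ _ hk, rhoG_prime_eq_one_add_reChar ha hirr hχ hQ2 hQa hp' hpQ]
    have h1 := Literature.NumberTheory.LFunctions.DirichletAbel.abs_reChar_le_one χ p
    rw [abs_le] at h1
    push_cast
    have : (1 : ℝ) ≤ n.factorization p := by exact_mod_cast hk
    linarith [h1.2]
  have h := hcast ▸ hle
  have h' : (n.factorization.prod fun p k => ((k + 1 : ℕ) : ℝ)) =
      ((∏ p ∈ n.primeFactors, (n.factorization p + 1) : ℕ) : ℝ) := by
    unfold Finsupp.prod
    rw [Nat.support_factorization]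
    push_cast
    rfl
  rw [h'] at h
  exact_mod_cast h

end RhoIdentity

/-! ### F. Combinatorial identities: Möbius detection of coprimality, squares, the `gcd` splitting -/

section Combinatorics

open ArithmeticFunction
open scoped ArithmeticFunction.Moebius ArithmeticFunction.zeta

/-- `∑_{d ∣ n} μ(d) = [n = 1]` (real-valued). [folklore] -/
theorem sum_divisors_moebius_eq_ite (n : ℕ) :
    ∑ d ∈ n.divisors, (μ d : ℝ) = if n = 1 then 1 else 0 := by
  have h := congrArg (fun f : ArithmeticFunction ℝ => f n)
    (coe_moebius_mul_coe_zeta : (μ * ζ : ArithmeticFunction ℝ) = 1)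
  simp only [coe_mul_zeta_apply, intCoe_apply, one_apply] at h
  exact h

/-- **Möbius detection of coprimality**: for `Q ≠ 0`, any finite set `A ⊆ ℕ` and weights `h`,
`∑_{k ∈ A, (k,Q)=1} h(k) = ∑_{f ∣ Q} μ(f) ∑_{k ∈ A, f ∣ k} h(k)`. [folklore] -/
theorem sum_filter_coprime_eq_sum_moebius {Q : ℕ} (hQ : Q ≠ 0) (A : Finset ℕ) (h : ℕ → ℝ) :
    ∑ k ∈ A.filter (fun k => k.Coprime Q), h k =
      ∑ f ∈ Q.divisors, (μ f : ℝ) * ∑ k ∈ A.filter (f ∣ ·), h k := by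
  have hswap : ∑ f ∈ Q.divisors, (μ f : ℝ) * ∑ k ∈ A.filter (f ∣ ·), h k =
      ∑ k ∈ A, h k * ∑ f ∈ Q.divisors.filter (· ∣ k), (μ f : ℝ) := by
    have h1 : ∀ f ∈ Q.divisors, (μ f : ℝ) * ∑ k ∈ A.filter (f ∣ ·), h k =
        ∑ k ∈ A, if f ∣ k then (μ f : ℝ) * h k else 0 := by
      intro f _
      rw [Finset.sum_filter, Finset.mul_sum]
      refine Finset.sum_congr rfl fun k _ => ?_
      split_ifs <;> simp
    rw [Finset.sum_congr rfl h1, Finset.sum_comm]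
    refine Finset.sum_congr rfl fun k _ => ?_
    rw [Finset.sum_filter, Finset.mul_sum]
    refine Finset.sum_congr rfl fun f _ => ?_
    split_ifs <;> ring
  rw [hswap, Finset.sum_filter]
  refine Finset.sum_congr rfl fun k _ => ?_
  have hset : Q.divisors.filter (· ∣ k) = (Q.gcd k).divisors := by
    ext f
    simp only [Finset.mem_filter, Nat.mem_divisors, Nat.dvd_gcd_iff]
    constructor
    · rintro ⟨⟨h1, -⟩, h2⟩; exact ⟨⟨h1, h2⟩, Nat.gcd_ne_zero_left hQ⟩
    · rintro ⟨⟨h1, h2⟩, -⟩; exact ⟨⟨h1, hQ⟩, h2⟩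
  rw [hset, sum_divisors_moebius_eq_ite]
  have hiff : Q.gcd k = 1 ↔ k.Coprime Q := by rw [Nat.Coprime, Nat.gcd_comm]
  by_cases hc : k.Coprime Q
  · rw [if_pos hc, if_pos (hiff.mpr hc), mul_one]
  · rw [if_neg hc, if_neg (fun h1 => hc (hiff.mp h1)), mul_zero]

/-- **Summing `λ = sqMoebius` against any function picks out the squares**:
`∑_{d ≤ N} λ(d) Φ(d) = ∑_{t ≤ √N} μ(t) Φ(t²)`. [folklore] -/
theorem sum_sqMoebius_mul_eq (N : ℕ) (Φ : ℕ → ℝ) :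
    ∑ d ∈ Finset.Icc 1 N, sqMoebius d * Φ d =
      ∑ t ∈ Finset.Icc 1 (Nat.sqrt N), (μ t : ℝ) * Φ (t * t) := by
  have hinj : Set.InjOn (fun t : ℕ => t * t) (Finset.Icc 1 (Nat.sqrt N) : Set ℕ) :=
    fun x _ y _ hxy => Nat.mul_self_inj.mp hxy
  have hR : ∑ t ∈ Finset.Icc 1 (Nat.sqrt N), (μ t : ℝ) * Φ (t * t) =
      ∑ d ∈ (Finset.Icc 1 (Nat.sqrt N)).image (fun t => t * t), sqMoebius d * Φ d := by
    rw [Finset.sum_image hinj]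
    refine Finset.sum_congr rfl fun t _ => ?_
    rw [sqMoebius_sq]
  rw [hR]
  symm
  apply Finset.sum_subset
  · intro d hd
    rw [Finset.mem_image] at hd
    obtain ⟨t, ht, rfl⟩ := hd
    rw [Finset.mem_Icc] at ht ⊢
    exact ⟨Nat.one_le_iff_ne_zero.mpr (mul_ne_zero (by omega) (by omega)),
      (Nat.mul_self_le_mul_self ht.2).trans (Nat.sqrt_le N)⟩
  · intro d hd hnot
    have h0 : sqMoebius d = 0 := by
      by_contra hne
      apply hnot
      have hsq := sqrt_mul_sqrt_of_sqMoebius_ne_zero hne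
      rw [Finset.mem_image]
      refine ⟨Nat.sqrt d, ?_, hsq⟩
      rw [Finset.mem_Icc] at hd ⊢
      constructor
      · by_contra h0
        push Not at h0
        have : Nat.sqrt d = 0 := by omega
        rw [this] at hsq; omega
      · exact Nat.sqrt_le_sqrt hd.2
    rw [h0, zero_mul]

/-- For a squarefree `e` and any `t`: `e ∣ t² k ↔ (e / gcd(e, t)) ∣ k`. [folklore] -/
theorem dvd_mul_self_mul_iff {e t k : ℕ} (he : Squarefree e) :
    e ∣ t * t * k ↔ e / Nat.gcd e t ∣ k := by
  set g := Nat.gcd e t with hg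
  have hg0 : g ≠ 0 := Nat.gcd_ne_zero_left he.ne_zero
  obtain ⟨e', he'⟩ : g ∣ e := Nat.gcd_dvd_left e t
  have hediv : e / g = e' := by rw [he', Nat.mul_div_cancel_left _ (Nat.pos_of_ne_zero hg0)]
  rw [hediv]
  -- `e'` is coprime to `t`
  have hcop : e'.Coprime t := by
    rw [Nat.coprime_iff_gcd_eq_one]
    by_contra hne
    obtain ⟨p, hp, hpd⟩ := Nat.exists_prime_and_dvd hne
    have hpe' : p ∣ e' := hpd.trans (Nat.gcd_dvd_left _ _)
    have hpt : p ∣ t := hpd.trans (Nat.gcd_dvd_right _ _)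
    have hpg : p ∣ g := Nat.dvd_gcd (he' ▸ hpe'.mul_left g) hpt
    have hp2 : p * p ∣ e := he' ▸ Nat.mul_dvd_mul hpg hpe'
    exact hp.one_lt.ne' (Nat.isUnit_iff.mp (he p hp2))
  constructor
  · intro h
    have h' : e' ∣ t * t * k := (Dvd.intro_left g he'.symm).trans h
    exact (hcop.mul_right hcop).dvd_of_dvd_mul_left h'
  · intro h
    have hgt : g ∣ t := Nat.gcd_dvd_right e t
    have h2 : g * e' ∣ t * k := Nat.mul_dvd_mul hgt h
    rw [he', show t * t * k = t * (t * k) by ring]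
    exact Dvd.dvd.mul_left h2 t

/-- **The `gcd`-splitting of a sum over squarefree integers prime to `N`**: for `e` squarefree and
prime to `N`, writing `t = s·u` with `s = gcd(t, e)`,
`∑_{t ≤ M, t squarefree, (t,N)=1} F(t) = ∑_{s ∣ e} ∑_{u ≤ M/s, u squarefree, (u, eN)=1} F(su)`.
[folklore] -/
theorem sum_squarefree_coprime_eq_sum_divisors {e N : ℕ} (he : Squarefree e) (heN : e.Coprime N)
    (M : ℕ) (F : ℕ → ℝ) :
    ∑ t ∈ (Finset.Icc 1 M).filter (fun t => Squarefree t ∧ t.Coprime N), F t =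
      ∑ s ∈ e.divisors, ∑ u ∈ (Finset.Icc 1 (M / s)).filter
        (fun u => Squarefree u ∧ u.Coprime (e * N)), F (s * u) := by
  have he0 : e ≠ 0 := he.ne_zero
  rw [Finset.sum_sigma']
  refine Finset.sum_nbij' (fun t => ⟨Nat.gcd t e, t / Nat.gcd t e⟩) (fun x => x.1 * x.2)
    ?_ ?_ ?_ ?_ ?_
  · -- maps into
    intro t ht
    rw [Finset.mem_filter, Finset.mem_Icc] at ht
    obtain ⟨⟨ht1, htM⟩, hsq, hcop⟩ := ht
    set s := Nat.gcd t e with hs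
    have hs0 : 0 < s := Nat.gcd_pos_of_pos_left _ (by omega)
    have hst : s ∣ t := Nat.gcd_dvd_left t e
    obtain ⟨u, hu⟩ := hst
    have hudef : t / s = u := by rw [hu, Nat.mul_div_cancel_left _ hs0]
    rw [Finset.mem_sigma, Nat.mem_divisors, Finset.mem_filter, Finset.mem_Icc, hudef]
    have hu0 : u ≠ 0 := by rintro rfl; rw [mul_zero] at hu; omega
    refine ⟨⟨Nat.gcd_dvd_right t e, he0⟩, ⟨Nat.one_le_iff_ne_zero.mpr hu0, ?_⟩, ?_, ?_⟩
    · rw [Nat.le_div_iff_mul_le hs0, mul_comm]; rw [← hu]; exact htM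
    · exact Squarefree.squarefree_of_dvd ⟨s, by rw [hu, mul_comm]⟩ hsq
    · refine Nat.Coprime.mul_right ?_ (Nat.Coprime.coprime_dvd_left ⟨s, by rw [hu, mul_comm]⟩ hcop)
      -- `u` is coprime to `e`: a common prime would divide `s = gcd(t, e)` and give `p² ∣ t`
      rw [Nat.coprime_iff_gcd_eq_one]
      by_contra hne
      obtain ⟨p, hp, hpd⟩ := Nat.exists_prime_and_dvd hne
      have hpu : p ∣ u := hpd.trans (Nat.gcd_dvd_left _ _)
      have hpe : p ∣ e := hpd.trans (Nat.gcd_dvd_right _ _)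
      have hps : p ∣ s := Nat.dvd_gcd (hu ▸ hpu.mul_left s) hpe
      have hp2 : p * p ∣ t := hu ▸ Nat.mul_dvd_mul hps hpu
      exact hp.one_lt.ne' (Nat.isUnit_iff.mp (hsq p hp2))
  · -- inverse maps into
    intro x hx
    rw [Finset.mem_sigma, Nat.mem_divisors, Finset.mem_filter, Finset.mem_Icc] at hx
    obtain ⟨⟨hse, -⟩, ⟨hu1, huM⟩, husq, hucop⟩ := hx
    have hs0 : 0 < x.1 := Nat.pos_of_dvd_of_pos hse (Nat.pos_of_ne_zero he0)
    rw [Finset.mem_filter, Finset.mem_Icc]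
    refine ⟨⟨Nat.one_le_iff_ne_zero.mpr (mul_ne_zero hs0.ne' (by omega)), ?_⟩, ?_, ?_⟩
    · rw [Nat.le_div_iff_mul_le hs0] at huM; rw [mul_comm]; exact huM
    · have hcop : x.1.Coprime x.2 :=
        Nat.Coprime.coprime_dvd_left hse (Nat.Coprime.coprime_mul_right_right hucop).symm
      exact (Nat.squarefree_mul hcop).mpr ⟨Squarefree.squarefree_of_dvd hse he, husq⟩
    · exact Nat.Coprime.mul_left (Nat.Coprime.coprime_dvd_left hse heN)
        (Nat.Coprime.coprime_mul_left_right hucop)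
  · -- left inverse
    intro t _
    exact Nat.mul_div_cancel' (Nat.gcd_dvd_left t e)
  · -- right inverse
    intro x hx
    obtain ⟨s, u⟩ := x
    rw [Finset.mem_sigma, Nat.mem_divisors, Finset.mem_filter, Finset.mem_Icc] at hx
    obtain ⟨⟨hse, -⟩, ⟨hu1, -⟩, -, hucop⟩ := hx
    have hs0 : 0 < s := Nat.pos_of_dvd_of_pos hse (Nat.pos_of_ne_zero he0)
    have hgcd : Nat.gcd (s * u) e = s := by
      obtain ⟨e', rfl⟩ := hse
      rw [Nat.gcd_mul_left]
      have : Nat.gcd u e' = 1 := by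
        have hue : u.Coprime (s * e') := Nat.Coprime.coprime_mul_right_right hucop
        exact Nat.Coprime.coprime_mul_left_right hue
      rw [this, mul_one]
    show (⟨Nat.gcd (s * u) e, s * u / Nat.gcd (s * u) e⟩ : (_ : ℕ) × ℕ) = ⟨s, u⟩
    rw [hgcd, Nat.mul_div_cancel_left _ hs0]
  · intro t _
    show F t = F (Nat.gcd t e * (t / Nat.gcd t e))
    rw [Nat.mul_div_cancel' (Nat.gcd_dvd_left t e)]

end Combinatorics

/-! ### G. The Euler factor `Z_N = ∑_{(t,N)=1} μ(t)/t²` -/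

section EulerFactor

open ArithmeticFunction Filter
open scoped ArithmeticFunction.Moebius Topology

/-- `n ↦ 1/n²` as a (real) arithmetic function. [folklore] -/
def invSq : ArithmeticFunction ℝ := ⟨fun n => 1 / (n : ℝ) ^ 2, by simp⟩

/-- `invSq n = 1/n²`. [folklore] -/
@[simp] theorem invSq_apply (n : ℕ) : invSq n = 1 / (n : ℝ) ^ 2 := rfl

/-- `invSq` is multiplicative (indeed completely multiplicative). [folklore] -/
theorem isMultiplicative_invSq : invSq.IsMultiplicative :=
  ⟨by simp, fun {m n} _ => by simp [mul_pow]; ring⟩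

/-- The terms `[ (t, N) = 1 ] μ(t)/t²` of `Z_N`. [folklore] -/
def zTerm (N : ℕ) (t : ℕ) : ℝ := if t.Coprime N then (μ t : ℝ) / (t : ℝ) ^ 2 else 0

/-- `Z_N = ∑_{t ≥ 1, (t,N)=1} μ(t)/t²` (`= ∏_{p ∤ N} (1 − p^{−2})`, an absolutely convergent
series). [folklore] -/
def zCoprime (N : ℕ) : ℝ := ∑' t : ℕ, zTerm N t

/-- `|zTerm N t| ≤ 1/t²`. [folklore] -/
theorem abs_zTerm_le (N t : ℕ) : |zTerm N t| ≤ 1 / (t : ℝ) ^ 2 := by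
  unfold zTerm
  split_ifs
  · rw [abs_div, abs_of_nonneg (by positivity : (0 : ℝ) ≤ (t : ℝ) ^ 2)]
    refine div_le_div_of_nonneg_right ?_ (by positivity)
    exact_mod_cast ArithmeticFunction.abs_moebius_le_one
  · rw [abs_zero]; positivity

/-- `zTerm N 0 = 0`. [folklore] -/
theorem zTerm_zero (N : ℕ) : zTerm N 0 = 0 := by
  unfold zTerm; split_ifs <;> simp

/-- The series `Z_N` converges absolutely. [folklore] -/
theorem summable_zTerm (N : ℕ) : Summable (zTerm N) :=
  Summable.of_norm_bounded (Real.summable_one_div_nat_pow.mpr one_lt_two)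
    fun t => by rw [Real.norm_eq_abs]; exact abs_zTerm_le N t

/-- The partial sums `I(M; N) = ∑_{t ≤ M, t squarefree, (t,N)=1} μ(t)/t²` of `Z_N`, as a range
sum of `zTerm`. [folklore] -/
theorem sum_range_zTerm (N M : ℕ) :
    ∑ t ∈ Finset.range (M + 1), zTerm N t =
      ∑ t ∈ (Finset.Icc 1 M).filter (fun t => Squarefree t ∧ t.Coprime N),
        (μ t : ℝ) / (t : ℝ) ^ 2 := by
  rw [Finset.range_eq_Ico, Finset.sum_eq_sum_Ico_succ_bot (by omega), zTerm_zero, zero_add,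
    Finset.sum_filter]
  have : Finset.Ico 1 (M + 1) = Finset.Icc 1 M := by
    ext t; simp only [Finset.mem_Ico, Finset.mem_Icc]; omega
  rw [this]
  refine Finset.sum_congr rfl fun t _ => ?_
  unfold zTerm
  by_cases hsq : Squarefree t
  · by_cases hc : t.Coprime N
    · rw [if_pos hc, if_pos ⟨hsq, hc⟩]
    · rw [if_neg hc, if_neg (fun h => hc h.2)]
  · rw [ArithmeticFunction.moebius_eq_zero_of_not_squarefree hsq]
    simp [hsq]

/-- `I(M; N) → Z_N` as `M → ∞`. [folklore] -/
theorem tendsto_partial_zCoprime (N : ℕ) :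
    Tendsto (fun M : ℕ => ∑ t ∈ (Finset.Icc 1 M).filter (fun t => Squarefree t ∧ t.Coprime N),
      (μ t : ℝ) / (t : ℝ) ^ 2) atTop (𝓝 (zCoprime N)) := by
  have h := (summable_zTerm N).hasSum.tendsto_sum_nat
  have h2 := h.comp (tendsto_add_atTop_nat 1)
  refine h2.congr fun M => ?_
  simp only [Function.comp_apply]
  exact sum_range_zTerm N M

/-- A telescoping bound: `∑_{i < n} 1/(i + M + 1)² ≤ 1/M` for `M ≥ 1`. [folklore] -/
theorem sum_range_inv_sq_shift_le {M : ℕ} (hM : 1 ≤ M) (n : ℕ) :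
    ∑ i ∈ Finset.range n, 1 / ((i + M + 1 : ℕ) : ℝ) ^ 2 ≤ 1 / (M : ℝ) := by
  have hkey : ∀ n : ℕ, ∑ i ∈ Finset.range n, 1 / ((i + M + 1 : ℕ) : ℝ) ^ 2 ≤
      1 / (M : ℝ) - 1 / ((n + M : ℕ) : ℝ) := by
    intro n
    induction n with
    | zero => simp
    | succ n ih =>
        rw [Finset.sum_range_succ]
        have hnM : (0 : ℝ) < ((n + M : ℕ) : ℝ) := by positivity
        have hstep : 1 / ((n + M + 1 : ℕ) : ℝ) ^ 2 ≤
            1 / ((n + M : ℕ) : ℝ) - 1 / ((n + 1 + M : ℕ) : ℝ) := by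
          have e1 : ((n + 1 + M : ℕ) : ℝ) = ((n + M : ℕ) : ℝ) + 1 := by push_cast; ring
          have e2 : ((n + M + 1 : ℕ) : ℝ) = ((n + M : ℕ) : ℝ) + 1 := by push_cast; ring
          rw [e1, e2, div_sub_div _ _ hnM.ne' (by positivity), one_mul, mul_one,
            add_sub_cancel_left, div_le_div_iff₀ (by positivity) (by positivity), one_mul, one_mul,
            pow_two]
          nlinarith
        linarith
  refine (hkey n).trans ?_
  have : 0 ≤ 1 / ((n + M : ℕ) : ℝ) := by positivity
  linarith

/-- **Tail bound**: `|Z_N − I(M; N)| ≤ 1/M` for `M ≥ 1`. [folklore] -/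
theorem abs_zCoprime_sub_partial_le (N : ℕ) {M : ℕ} (hM : 1 ≤ M) :
    |zCoprime N - ∑ t ∈ (Finset.Icc 1 M).filter (fun t => Squarefree t ∧ t.Coprime N),
      (μ t : ℝ) / (t : ℝ) ^ 2| ≤ 1 / (M : ℝ) := by
  rw [← sum_range_zTerm, zCoprime, ← (summable_zTerm N).sum_add_tsum_nat_add (M + 1),
    add_sub_cancel_left]
  have hsum : Summable fun i : ℕ => zTerm N (i + (M + 1)) :=
    (summable_nat_add_iff (M + 1)).mpr (summable_zTerm N)
  have habs : Summable fun i : ℕ => |zTerm N (i + (M + 1))| := hsum.abs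
  calc |∑' i : ℕ, zTerm N (i + (M + 1))| ≤ ∑' i : ℕ, |zTerm N (i + (M + 1))| := by
        have := norm_tsum_le_tsum_norm hsum.norm
        simpa only [Real.norm_eq_abs] using this
    _ ≤ 1 / (M : ℝ) := by
        refine Real.tsum_le_of_sum_range_le (fun i => abs_nonneg _) fun n => ?_
        refine le_trans (Finset.sum_le_sum fun i _ => abs_zTerm_le N (i + (M + 1))) ?_
        refine le_trans (le_of_eq ?_) (sum_range_inv_sq_shift_le hM n)
        refine Finset.sum_congr rfl fun i _ => ?_
        rw [show i + (M + 1) = i + M + 1 by ring]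

/-- `∑_{s ∣ e} μ(s)/s² = ∏_{p ∣ e} (1 − p^{−2})` for squarefree `e`. [folklore] -/
theorem sum_divisors_moebius_div_sq {e : ℕ} (he : Squarefree e) :
    ∑ s ∈ e.divisors, (μ s : ℝ) / (s : ℝ) ^ 2 = ∏ p ∈ e.primeFactors, (1 - 1 / (p : ℝ) ^ 2) := by
  have h := ArithmeticFunction.IsMultiplicative.prodPrimeFactors_one_sub_of_squarefree _
    isMultiplicative_invSq he
  simp only [invSq_apply] at h
  rw [h]
  refine Finset.sum_congr rfl fun s _ => ?_
  ring

/-- The Euler factor `∏_{p ∣ e} (1 − p^{−2}) ≥ 1/2` hmm — we only need positivity: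
`0 < ∏_{p ∣ e} (1 − p^{−2}) ≤ 1`. [folklore] -/
theorem prod_primeFactors_one_sub_inv_sq_pos (e : ℕ) :
    0 < ∏ p ∈ e.primeFactors, (1 - 1 / (p : ℝ) ^ 2) := by
  refine Finset.prod_pos fun p hp => ?_
  have hp2 : (2 : ℝ) ≤ p := by exact_mod_cast (Nat.prime_of_mem_primeFactors hp).two_le
  have : 1 / (p : ℝ) ^ 2 ≤ 1 / 4 := by
    rw [div_le_div_iff₀ (by positivity) (by positivity)]; nlinarith
  linarith

/-- The Euler factor is at most `1`. [folklore] -/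
theorem prod_primeFactors_one_sub_inv_sq_le_one (e : ℕ) :
    ∏ p ∈ e.primeFactors, (1 - 1 / (p : ℝ) ^ 2) ≤ 1 := by
  refine Finset.prod_le_one (fun p hp => ?_) fun p hp => ?_
  · have hp2 : (2 : ℝ) ≤ p := by exact_mod_cast (Nat.prime_of_mem_primeFactors hp).two_le
    have : 1 / (p : ℝ) ^ 2 ≤ 1 / 4 := by
      rw [div_le_div_iff₀ (by positivity) (by positivity)]; nlinarith
    linarith
  · have : 0 ≤ 1 / (p : ℝ) ^ 2 := by positivity
    linarith

/-- `M ↦ M / s` tends to infinity (`s ≥ 1`). [folklore] -/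
theorem tendsto_nat_div_atTop {s : ℕ} (hs : 1 ≤ s) : Tendsto (fun M : ℕ => M / s) atTop atTop := by
  refine tendsto_atTop_atTop.mpr fun b => ⟨b * s, fun M hM => ?_⟩
  exact (Nat.le_div_iff_mul_le (by omega)).mpr hM

/-- **Removing Euler factors**: for `e` squarefree and prime to `N`,
`Z_N = ∏_{p ∣ e} (1 − p^{−2}) · Z_{eN}` — the finite identity
`I(M; N) = ∑_{s ∣ e} μ(s) s^{−2} I(M/s; eN)` (`sum_squarefree_coprime_eq_sum_divisors`) in the
limit `M → ∞`. [folklore] -/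
theorem zCoprime_eq_prod_mul {e N : ℕ} (he : Squarefree e) (heN : e.Coprime N) :
    zCoprime N = (∏ p ∈ e.primeFactors, (1 - 1 / (p : ℝ) ^ 2)) * zCoprime (e * N) := by
  -- the finite identity
  have hfin : ∀ M : ℕ, ∑ t ∈ (Finset.Icc 1 M).filter (fun t => Squarefree t ∧ t.Coprime N),
      (μ t : ℝ) / (t : ℝ) ^ 2 = ∑ s ∈ e.divisors, (μ s : ℝ) / (s : ℝ) ^ 2 *
        ∑ u ∈ (Finset.Icc 1 (M / s)).filter (fun u => Squarefree u ∧ u.Coprime (e * N)),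
          (μ u : ℝ) / (u : ℝ) ^ 2 := by
    intro M
    rw [sum_squarefree_coprime_eq_sum_divisors he heN M (fun t => (μ t : ℝ) / (t : ℝ) ^ 2)]
    refine Finset.sum_congr rfl fun s hs => ?_
    rw [Finset.mul_sum]
    refine Finset.sum_congr rfl fun u hu => ?_
    rw [Finset.mem_filter] at hu
    have hsu : s.Coprime u :=
      (Nat.Coprime.coprime_dvd_left (Nat.dvd_of_mem_divisors hs)
        (Nat.Coprime.coprime_mul_right_right hu.2.2).symm)
    rw [ArithmeticFunction.isMultiplicative_moebius.map_mul_of_coprime hsu]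
    push_cast
    have hs0 : (s : ℝ) ≠ 0 := by exact_mod_cast (Nat.pos_of_mem_divisors hs).ne'
    have hu0 : (u : ℝ) ≠ 0 := by
      have := (Finset.mem_Icc.mp hu.1).1
      exact_mod_cast (show u ≠ 0 by omega)
    field_simp
  -- the limits of both sides
  have hL := tendsto_partial_zCoprime N
  have hR : Tendsto (fun M : ℕ => ∑ s ∈ e.divisors, (μ s : ℝ) / (s : ℝ) ^ 2 *
      ∑ u ∈ (Finset.Icc 1 (M / s)).filter (fun u => Squarefree u ∧ u.Coprime (e * N)),
        (μ u : ℝ) / (u : ℝ) ^ 2) atTop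
      (𝓝 (∑ s ∈ e.divisors, (μ s : ℝ) / (s : ℝ) ^ 2 * zCoprime (e * N))) := by
    refine tendsto_finsetSum _ fun s hs => ?_
    refine Tendsto.const_mul _ ?_
    exact (tendsto_partial_zCoprime (e * N)).comp
      (tendsto_nat_div_atTop (Nat.pos_of_mem_divisors hs))
  have heq := tendsto_nhds_unique hL (hR.congr' (Eventually.of_forall fun M => (hfin M).symm))
  rw [heq, ← Finset.sum_mul, sum_divisors_moebius_div_sq he]

/-- **`Z_N ≥ 2 − π²/6 > 1/3`**: `Z_N = 1 + ∑_{t ≥ 2} (…)` with `|…| ≤ 1/t²` and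
`∑_{t ≥ 2} 1/t² = π²/6 − 1`. [folklore] -/
theorem one_third_le_zCoprime (N : ℕ) : 1 / 3 ≤ zCoprime N := by
  -- compare termwise with `l(t) = 2·[t = 1] − 1/t²`
  set l : ℕ → ℝ := fun t => (if t = 1 then 2 else 0) - 1 / (t : ℝ) ^ 2 with hl
  have hl1 : HasSum (fun t : ℕ => (if t = 1 then (2 : ℝ) else 0)) 2 := hasSum_ite_eq 1 2
  have hlsum : HasSum l (2 - Real.pi ^ 2 / 6) := hl1.sub hasSum_zeta_two
  have hle : ∀ t, l t ≤ zTerm N t := by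
    intro t
    simp only [hl]
    rcases eq_or_ne t 1 with rfl | ht
    · simp [zTerm]; norm_num
    · rw [if_neg ht, zero_sub]
      have := abs_zTerm_le N t
      rw [abs_le] at this
      exact this.1
  have hcmp : 2 - Real.pi ^ 2 / 6 ≤ zCoprime N := by
    rw [← hlsum.tsum_eq]
    exact hlsum.summable.tsum_le_tsum hle (summable_zTerm N)
  have hpi : Real.pi ^ 2 < 10 := by
    have := Real.pi_lt_d2
    nlinarith [Real.pi_pos]
  linarith

/-- `|Z_N| ≤ 2` (indeed `≤ π²/6`). [folklore] -/
theorem abs_zCoprime_le_two (N : ℕ) : |zCoprime N| ≤ 2 := by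
  have h1 : ‖zCoprime N‖ ≤ ∑' t : ℕ, 1 / (t : ℝ) ^ 2 := by
    unfold zCoprime
    refine tsum_of_norm_bounded hasSum_zeta_two.summable.hasSum fun t => ?_
    rw [Real.norm_eq_abs]; exact abs_zTerm_le N t
  rw [hasSum_zeta_two.tsum_eq] at h1
  rw [Real.norm_eq_abs] at h1
  have hpi : Real.pi ^ 2 < 10 := by
    have := Real.pi_lt_d2
    nlinarith [Real.pi_pos]
  linarith

end EulerFactor

/-! ### H. The sieve density `g` attached to `ρ_G` and the level coefficients of `r` -/

section Density

open ArithmeticFunction Iwaniec1978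
open scoped ArithmeticFunction.Moebius NumberTheorySymbols
open Literature.NumberTheory.LFunctions (DirichletAbel.reChar RealChar.charDivisorSum
  RealChar.charDivisorDensity RealChar.charDivisorDensity_prime RealChar.charDivisorDensity_apply
  RealChar.isMultiplicative_charDivisorDensity RealChar.charDivisorSum_div_le_card_divisors)

variable {a b c : ℤ} {Q : ℕ}
variable {χ : DirichletCharacter ℂ (4 * (b ^ 2 - 4 * a * c).natAbs)}

/-- **The sieve density attached to `ρ_G` and the bad modulus `Q`**: the multiplicative function
with `g(p) = ρ_G(p)/(p − 1 + ρ_G(p))` at the primes `p ∤ Q` and `g(p) = 0` at `p ∣ Q` (value at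
`e` = product over the distinct prime factors of `e`).  For `(e, Q) = 1` squarefree it is the
relative density of the multiples of `e` for the weights `ρ_G(m)/m` on the integers prime to `Q`.
[folklore] -/
def rhoDensity (a b c : ℤ) (Q : ℕ) : ArithmeticFunction ℝ :=
  ArithmeticFunction.prodPrimeFactors fun p =>
    if p ∣ Q then 0 else (rhoG a b c p : ℝ) / ((p : ℝ) - 1 + rhoG a b c p)

/-- `g` is multiplicative. [folklore] -/
theorem isMultiplicative_rhoDensity (a b c : ℤ) (Q : ℕ) : (rhoDensity a b c Q).IsMultiplicative :=
  ArithmeticFunction.IsMultiplicative.prodPrimeFactors _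

/-- `g` at a prime. [folklore] -/
theorem rhoDensity_prime (a b c : ℤ) (Q : ℕ) {p : ℕ} (hp : p.Prime) :
    rhoDensity a b c Q p =
      if p ∣ Q then 0 else (rhoG a b c p : ℝ) / ((p : ℝ) - 1 + rhoG a b c p) := by
  rw [rhoDensity, ArithmeticFunction.prodPrimeFactors_apply hp.ne_zero, hp.primeFactors,
    Finset.prod_singleton]

/-- `0 ≤ g(p) < 1` at every prime. [folklore] -/
theorem rhoDensity_prime_nonneg_lt_one (a b c : ℤ) (Q : ℕ) {p : ℕ} (hp : p.Prime) :
    0 ≤ rhoDensity a b c Q p ∧ rhoDensity a b c Q p < 1 := by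
  rw [rhoDensity_prime a b c Q hp]
  split_ifs
  · exact ⟨le_rfl, zero_lt_one⟩
  · have hp1 : (1 : ℝ) ≤ (p : ℝ) - 1 := by
      have : (2 : ℝ) ≤ p := by exact_mod_cast hp.two_le
      linarith
    have hρ : (0 : ℝ) ≤ rhoG a b c p := Nat.cast_nonneg _
    refine ⟨div_nonneg hρ (by linarith), ?_⟩
    rw [div_lt_one (by linarith)]
    linarith

/-- `g(p) ≤ ρ_G(p)/p` at every prime. [folklore] -/
theorem rhoDensity_prime_le (a b c : ℤ) (Q : ℕ) {p : ℕ} (hp : p.Prime) :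
    rhoDensity a b c Q p ≤ (rhoG a b c p : ℝ) / p := by
  rw [rhoDensity_prime a b c Q hp]
  have hp0 : (0 : ℝ) < p := by exact_mod_cast hp.pos
  split_ifs
  · positivity
  · have hρ : (0 : ℝ) ≤ rhoG a b c p := Nat.cast_nonneg _
    rcases Nat.eq_zero_or_pos (rhoG a b c p) with h0 | hpos
    · rw [h0]; simp
    · have h1 : (1 : ℝ) ≤ rhoG a b c p := by exact_mod_cast hpos
      exact div_le_div_of_nonneg_left hρ hp0 (by linarith)

/-- **`g(p) = (g_r(p) − p^{−2})/(1 − p^{−2})` at the good primes**, where `g_r` is the density of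
`r = χ ∗ 1` (`RealChar.charDivisorDensity`): with `ρ_G(p) = 1 + χ(p)`, `χ(p) = ±1`, both sides are
`2/(p+1)` resp. `0`. [folklore] -/
theorem rhoDensity_prime_eq (ha : 0 < a) (hirr : Irreducible (quadPoly a b c))
    (hχ : ∀ n : ℕ, Odd n → χ n = (J(b ^ 2 - 4 * a * c | n) : ℂ))
    (hQ2 : 2 ∣ Q) (hQa : ∀ p : ℕ, p.Prime → (p : ℤ) ∣ a → p ∣ Q)
    (hQΔ : ∀ p : ℕ, p.Prime → (p : ℤ) ∣ b ^ 2 - 4 * a * c → p ∣ Q)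
    {p : ℕ} (hp : p.Prime) (hpQ : ¬ p ∣ Q) :
    rhoDensity a b c Q p =
      (RealChar.charDivisorDensity χ p - 1 / (p : ℝ) ^ 2) / (1 - 1 / (p : ℝ) ^ 2) := by
  have hΔ0 : b ^ 2 - 4 * a * c ≠ 0 := disc_ne_zero ha.ne' hirr
  have hq : χ ^ 2 = 1 := chi_sq_eq_one hΔ0 hχ
  rw [rhoDensity_prime a b c Q hp, if_neg hpQ, rhoG_prime_eq_one_add_reChar ha hirr hχ hQ2 hQa hp hpQ,
    RealChar.charDivisorDensity_prime χ hq hp]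
  have hp2 : (2 : ℝ) ≤ p := by exact_mod_cast hp.two_le
  have hp0 : (p : ℝ) ≠ 0 := by positivity
  have hp1 : (p : ℝ) ^ 2 - 1 ≠ 0 := by nlinarith
  rcases reChar_good_prime hχ hQ2 hQΔ hp hpQ with h | h <;> rw [h] <;> field_simp <;> ring

/-- `G_e := ∑_{s ∣ e} μ(s) s^{−2} g_r(e/s) = ∏_{p ∣ e} (g_r(p) − p^{−2})` for squarefree `e`
(Mathlib's `prodPrimeFactors_add_of_squarefree`). [folklore] -/
theorem sum_divisors_moebius_div_sq_mul_density (hq : χ ^ 2 = 1) {e : ℕ} (he : Squarefree e) :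
    ∑ s ∈ e.divisors, (μ s : ℝ) / (s : ℝ) ^ 2 * RealChar.charDivisorDensity χ (e / s) =
      ∏ p ∈ e.primeFactors, (RealChar.charDivisorDensity χ p - 1 / (p : ℝ) ^ 2) := by
  have hf : ((μ : ArithmeticFunction ℝ).pmul invSq).IsMultiplicative :=
    ArithmeticFunction.isMultiplicative_moebius.intCast.pmul isMultiplicative_invSq
  have h := ArithmeticFunction.IsMultiplicative.prodPrimeFactors_add_of_squarefree hf
    (RealChar.isMultiplicative_charDivisorDensity χ hq) he
  rw [ArithmeticFunction.prodPrimeFactors_apply he.ne_zero] at h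
  rw [ArithmeticFunction.mul_apply, Nat.sum_divisorsAntidiagonal (fun x y =>
    ((μ : ArithmeticFunction ℝ).pmul invSq) x * RealChar.charDivisorDensity χ y)] at h
  simp only [ArithmeticFunction.add_apply, ArithmeticFunction.pmul_apply,
    ArithmeticFunction.intCoe_apply, invSq_apply] at h
  calc ∑ s ∈ e.divisors, (μ s : ℝ) / (s : ℝ) ^ 2 * RealChar.charDivisorDensity χ (e / s)
      = ∑ s ∈ e.divisors, (μ s : ℝ) * (1 / (s : ℝ) ^ 2) * RealChar.charDivisorDensity χ (e / s) :=
        Finset.sum_congr rfl fun s _ => by ring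
    _ = ∏ p ∈ e.primeFactors, ((μ p : ℝ) * (1 / (p : ℝ) ^ 2) + RealChar.charDivisorDensity χ p) :=
        h.symm
    _ = _ := by
        refine Finset.prod_congr rfl fun p hp => ?_
        rw [ArithmeticFunction.moebius_apply_prime (Nat.prime_of_mem_primeFactors hp)]
        push_cast
        ring

/-- **`g(e) = G_e / ∏_{p ∣ e}(1 − p^{−2})`** for `e` squarefree and prime to `Q`. [folklore] -/
theorem rhoDensity_eq_div (ha : 0 < a) (hirr : Irreducible (quadPoly a b c))
    (hχ : ∀ n : ℕ, Odd n → χ n = (J(b ^ 2 - 4 * a * c | n) : ℂ))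
    (hQ2 : 2 ∣ Q) (hQa : ∀ p : ℕ, p.Prime → (p : ℤ) ∣ a → p ∣ Q)
    (hQΔ : ∀ p : ℕ, p.Prime → (p : ℤ) ∣ b ^ 2 - 4 * a * c → p ∣ Q)
    {e : ℕ} (he : Squarefree e) (heQ : e.Coprime Q) :
    rhoDensity a b c Q e =
      (∏ p ∈ e.primeFactors, (RealChar.charDivisorDensity χ p - 1 / (p : ℝ) ^ 2)) /
        ∏ p ∈ e.primeFactors, (1 - 1 / (p : ℝ) ^ 2) := by
  rw [← (isMultiplicative_rhoDensity a b c Q).prod_primeFactors he, ← Finset.prod_div_distrib]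
  refine Finset.prod_congr rfl fun p hp => ?_
  have hp' := Nat.prime_of_mem_primeFactors hp
  have hpQ : ¬ p ∣ Q := (Nat.Prime.coprime_iff_not_dvd hp').mp
    (Nat.Coprime.coprime_dvd_left (Nat.dvd_of_mem_primeFactors hp) heQ)
  exact rhoDensity_prime_eq ha hirr hχ hQ2 hQa hQΔ hp' hpQ

/-- `|g_r(d)| ≤ τ(d)²/d ≤ τ(d)²` (from `g_r(d) = d^{−1} ∑_{h ∣ d} μ(h)χ(h)h^{−1} r(d/h)`).
[folklore] -/
theorem abs_charDivisorDensity_le (hq : χ ^ 2 = 1) {d : ℕ} (hd : d ≠ 0) :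
    |RealChar.charDivisorDensity χ d| ≤ (#d.divisors : ℝ) ^ 2 := by
  rw [RealChar.charDivisorDensity_apply, abs_mul]
  have hd1 : (1 : ℝ) ≤ d := by exact_mod_cast Nat.one_le_iff_ne_zero.mpr hd
  have h1 : |((d : ℝ))⁻¹| ≤ 1 := by
    rw [abs_of_nonneg (by positivity)]
    exact inv_le_one_of_one_le₀ hd1
  have h2 : |∑ h ∈ d.divisors, (μ h : ℝ) * DirichletAbel.reChar χ h * (h : ℝ)⁻¹ *
      RealChar.charDivisorSum χ (d / h)| ≤ (#d.divisors : ℝ) ^ 2 := by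
    refine (Finset.abs_sum_le_sum_abs _ _).trans ?_
    have hterm : ∀ h ∈ d.divisors, |(μ h : ℝ) * DirichletAbel.reChar χ h * (h : ℝ)⁻¹ *
        RealChar.charDivisorSum χ (d / h)| ≤ #d.divisors := by
      intro h hh
      have hh1 : (1 : ℝ) ≤ h := by exact_mod_cast Nat.pos_of_mem_divisors hh
      rw [abs_mul, abs_mul, abs_mul]
      have hμ : |(μ h : ℝ)| ≤ 1 := by exact_mod_cast ArithmeticFunction.abs_moebius_le_one
      have hχ1 := Literature.NumberTheory.LFunctions.DirichletAbel.abs_reChar_le_one χ h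
      have hinv : |((h : ℝ))⁻¹| ≤ 1 := by
        rw [abs_of_nonneg (by positivity)]; exact inv_le_one_of_one_le₀ hh1
      have hr := RealChar.charDivisorSum_div_le_card_divisors χ hq hd (Nat.dvd_of_mem_divisors hh)
      calc |(μ h : ℝ)| * |DirichletAbel.reChar χ h| * |((h : ℝ))⁻¹| *
            |RealChar.charDivisorSum χ (d / h)| ≤ 1 * 1 * 1 * #d.divisors := by
            gcongr
        _ = #d.divisors := by ring
    refine (Finset.sum_le_sum hterm).trans ?_
    rw [Finset.sum_const, nsmul_eq_mul, pow_two]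
  calc |((d : ℝ))⁻¹| * |∑ h ∈ d.divisors, (μ h : ℝ) * DirichletAbel.reChar χ h * (h : ℝ)⁻¹ *
        RealChar.charDivisorSum χ (d / h)| ≤ 1 * (#d.divisors : ℝ) ^ 2 :=
        mul_le_mul h1 h2 (abs_nonneg _) zero_le_one
    _ = _ := one_mul _

end Density

/-! ### I. The main estimate: `∑_{n ≤ N, e ∣ n, (n,Q)=1} ρ_G(n) = 𝔠 g(e) N + O(τ(e)³ √N log N)` -/

section MainEstimate

open ArithmeticFunction Iwaniec1978
open scoped ArithmeticFunction.Moebius NumberTheorySymbols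
open Literature.NumberTheory.LFunctions (DirichletAbel.reChar RealChar.charDivisorSum
  RealChar.charDivisorDensity RealChar.abs_congrSum_charDivisorSum_sub_le
  RealChar.isMultiplicative_charDivisorDensity RealChar.abs_charDivisorSum_le
  RealChar.charDivisorSum_nonneg)

variable {a b c : ℤ} {Q : ℕ}
variable {χ : DirichletCharacter ℂ (4 * (b ^ 2 - 4 * a * c).natAbs)}

/-- `gcd(e, s·u) = s` for `s ∣ e` and `u` prime to `e`. [folklore] -/
theorem gcd_eq_of_dvd_of_coprime {e s u : ℕ} (hse : s ∣ e) (hue : u.Coprime e) :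
    Nat.gcd e (s * u) = s := by
  obtain ⟨e', rfl⟩ := hse
  rw [Nat.gcd_mul_left]
  have : Nat.gcd e' u = 1 :=
    Nat.Coprime.coprime_dvd_left (dvd_mul_left e' s) hue.symm
  rw [this, mul_one]

/-- **The combinatorial reduction** of `∑_{n ≤ N, e ∣ n, (n,Q)=1} ρ_G(n)` to sums of `r` over
multiples: with `ρ_G = λ ∗ r` (`rhoG_eq_sqMoebius_mul_charDivisorSum`), the hyperbola
rearrangement, `λ` supported on squares, `e ∣ t²k ↔ e_t ∣ k` (`e_t = e/gcd(e,t)`) and Möbius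
detection of `(k, Q) = 1`:
`∑ = ∑_{t ≤ √N, (t,Q)=1} μ(t) ∑_{f ∣ Q} μ(f) ∑_{k ≤ N/t², e_t f ∣ k} r(k)`. [folklore] -/
theorem rhoSum_eq_sum_sqrt (ha : 0 < a) (hirr : Irreducible (quadPoly a b c))
    (hχ : ∀ n : ℕ, Odd n → χ n = (J(b ^ 2 - 4 * a * c | n) : ℂ))
    (hQ2 : 2 ∣ Q) (hQa : ∀ p : ℕ, p.Prime → (p : ℤ) ∣ a → p ∣ Q)
    (hQΔ : ∀ p : ℕ, p.Prime → (p : ℤ) ∣ b ^ 2 - 4 * a * c → p ∣ Q)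
    (hpow : ∀ p : ℕ, p.Prime → ¬ p ∣ Q → ∀ k : ℕ, 1 ≤ k → rhoG a b c (p ^ k) = rhoG a b c p)
    (hQ0 : Q ≠ 0) {e : ℕ} (he : Squarefree e) (heQ : e.Coprime Q) (N : ℕ) :
    ∑ n ∈ (Finset.Icc 1 N).filter (fun n => e ∣ n ∧ n.Coprime Q), (rhoG a b c n : ℝ) =
      ∑ t ∈ (Finset.Icc 1 (Nat.sqrt N)).filter (fun t => t.Coprime Q), (μ t : ℝ) *
        ∑ f ∈ Q.divisors, (μ f : ℝ) *
          ∑ k ∈ (Finset.Icc 1 (N / (t * t))).filter (fun k => e / Nat.gcd e t * f ∣ k),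
            RealChar.charDivisorSum χ k := by
  classical
  set r := RealChar.charDivisorSum χ with hr
  set w : ℕ → ℝ := fun n => if e ∣ n ∧ n.Coprime Q then 1 else 0 with hw
  have h1 : ∑ n ∈ (Finset.Icc 1 N).filter (fun n => e ∣ n ∧ n.Coprime Q), (rhoG a b c n : ℝ) =
      ∑ n ∈ Finset.Icc 1 N, w n * (sqMoebius * r) n := by
    rw [Finset.sum_filter]
    refine Finset.sum_congr rfl fun n _ => ?_
    simp only [hw]
    split_ifs with hcond
    · rw [one_mul]
      exact rhoG_eq_sqMoebius_mul_charDivisorSum ha hirr hχ hQ2 hQa hQΔ hpow hcond.2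
    · rw [zero_mul]
  have h2 : ∑ n ∈ Finset.Icc 1 N, w n * (sqMoebius * r) n =
      ∑ n ∈ Finset.Icc 1 N, ∑ x ∈ n.divisorsAntidiagonal,
        w (x.1 * x.2) * (sqMoebius x.1 * r x.2) := by
    refine Finset.sum_congr rfl fun n _ => ?_
    rw [ArithmeticFunction.mul_apply, Finset.mul_sum]
    refine Finset.sum_congr rfl fun x hx => ?_
    rw [(Nat.mem_divisorsAntidiagonal.mp hx).1]
  have h3 := SquarefreeSums.sum_Icc_sum_divisorsAntidiagonal
    (fun d k => w (d * k) * (sqMoebius d * r k)) N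
  have h4 : ∑ d ∈ Finset.Icc 1 N, ∑ k ∈ Finset.Icc 1 (N / d), w (d * k) * (sqMoebius d * r k) =
      ∑ d ∈ Finset.Icc 1 N, sqMoebius d * ∑ k ∈ Finset.Icc 1 (N / d), w (d * k) * r k := by
    refine Finset.sum_congr rfl fun d _ => ?_
    rw [Finset.mul_sum]
    refine Finset.sum_congr rfl fun k _ => ?_
    ring
  rw [h1, h2, h3, h4, sum_sqMoebius_mul_eq N (fun d => ∑ k ∈ Finset.Icc 1 (N / d), w (d * k) * r k),
    Finset.sum_filter]
  refine Finset.sum_congr rfl fun t _ => ?_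
  by_cases htQ : t.Coprime Q
  · rw [if_pos htQ]
    congr 1
    have hcond : ∀ k, (e ∣ t * t * k ∧ (t * t * k).Coprime Q) ↔
        (e / Nat.gcd e t ∣ k ∧ k.Coprime Q) := by
      intro k
      rw [dvd_mul_self_mul_iff he, Nat.coprime_mul_iff_left, Nat.coprime_mul_iff_left]
      tauto
    have hΦ : ∑ k ∈ Finset.Icc 1 (N / (t * t)), w (t * t * k) * r k =
        ∑ k ∈ ((Finset.Icc 1 (N / (t * t))).filter (fun k => e / Nat.gcd e t ∣ k)).filter
          (fun k => k.Coprime Q), r k := by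
      rw [Finset.filter_filter, Finset.sum_filter]
      refine Finset.sum_congr rfl fun k _ => ?_
      simp only [hw]
      by_cases hc : e / Nat.gcd e t ∣ k ∧ k.Coprime Q
      · rw [if_pos ((hcond k).mpr hc), if_pos hc, one_mul]
      · rw [if_neg (fun h => hc ((hcond k).mp h)), if_neg hc, zero_mul]
    rw [hΦ, sum_filter_coprime_eq_sum_moebius hQ0]
    refine Finset.sum_congr rfl fun f hf => ?_
    congr 1
    have hcop : (e / Nat.gcd e t).Coprime f :=
      Nat.Coprime.coprime_dvd_left (Nat.div_dvd_of_dvd (Nat.gcd_dvd_left e t))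
        (Nat.Coprime.coprime_dvd_right (Nat.dvd_of_mem_divisors hf) heQ)
    rw [Finset.filter_filter]
    congr 1
    ext k
    simp only [Finset.mem_filter]
    constructor
    · rintro ⟨hk, h1, h2⟩; exact ⟨hk, hcop.mul_dvd_of_dvd_of_dvd h1 h2⟩
    · rintro ⟨hk, h⟩; exact ⟨hk, (dvd_mul_right _ _).trans h, (dvd_mul_left _ _).trans h⟩
  · rw [if_neg htQ]
    have : ∑ k ∈ Finset.Icc 1 (N / (t * t)), w (t * t * k) * r k = 0 := by
      refine Finset.sum_eq_zero fun k _ => ?_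
      simp only [hw]
      rw [if_neg, zero_mul]
      rintro ⟨-, hc⟩
      exact htQ (Nat.Coprime.coprime_mul_right (Nat.Coprime.coprime_mul_right hc))
    rw [this, mul_zero]

/-- **The singular factor**: for `T ≥ 1` and `e` squarefree prime to `Q`,
`|∑_{t ≤ T, (t,Q)=1} μ(t) g_r(e/gcd(e,t))/t² − g(e) Z_Q| ≤ 2 τ(e)³/T` (the `gcd`-splitting,
the tail bound for `Z_{eQ}`, and `G_e Z_{eQ} = g(e) Z_Q`). [folklore] -/
theorem abs_singularSum_sub_le (ha : 0 < a) (hirr : Irreducible (quadPoly a b c))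
    (hχ : ∀ n : ℕ, Odd n → χ n = (J(b ^ 2 - 4 * a * c | n) : ℂ))
    (hQ2 : 2 ∣ Q) (hQa : ∀ p : ℕ, p.Prime → (p : ℤ) ∣ a → p ∣ Q)
    (hQΔ : ∀ p : ℕ, p.Prime → (p : ℤ) ∣ b ^ 2 - 4 * a * c → p ∣ Q)
    {e : ℕ} (he : Squarefree e) (heQ : e.Coprime Q) {T : ℕ} (hT : 1 ≤ T) :
    |∑ t ∈ (Finset.Icc 1 T).filter (fun t => t.Coprime Q),
        (μ t : ℝ) * RealChar.charDivisorDensity χ (e / Nat.gcd e t) / ((t : ℝ) ^ 2) -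
      rhoDensity a b c Q e * zCoprime Q| ≤ 2 * (#e.divisors : ℝ) ^ 3 / T := by
  have hΔ0 : b ^ 2 - 4 * a * c ≠ 0 := disc_ne_zero ha.ne' hirr
  have hq : χ ^ 2 = 1 := chi_sq_eq_one hΔ0 hχ
  have he0 : e ≠ 0 := he.ne_zero
  have hT0 : (0 : ℝ) < T := by exact_mod_cast hT
  set gr := RealChar.charDivisorDensity χ with hgr
  -- (i) restrict to squarefree `t`
  have hsq : ∑ t ∈ (Finset.Icc 1 T).filter (fun t => t.Coprime Q),
      (μ t : ℝ) * gr (e / Nat.gcd e t) / ((t : ℝ) ^ 2) =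
      ∑ t ∈ (Finset.Icc 1 T).filter (fun t => Squarefree t ∧ t.Coprime Q),
        (μ t : ℝ) * gr (e / Nat.gcd e t) / ((t : ℝ) ^ 2) := by
    rw [Finset.sum_filter, Finset.sum_filter]
    refine Finset.sum_congr rfl fun t _ => ?_
    by_cases hs : Squarefree t
    · simp [hs]
    · rw [ArithmeticFunction.moebius_eq_zero_of_not_squarefree hs]
      simp [hs]
  -- (ii) the `gcd`-splitting
  have hsplit := sum_squarefree_coprime_eq_sum_divisors he heQ T
    (fun t => (μ t : ℝ) * gr (e / Nat.gcd e t) / ((t : ℝ) ^ 2))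
  have hinner : ∀ s ∈ e.divisors, ∑ u ∈ (Finset.Icc 1 (T / s)).filter
      (fun u => Squarefree u ∧ u.Coprime (e * Q)),
        (μ (s * u) : ℝ) * gr (e / Nat.gcd e (s * u)) / (((s * u : ℕ) : ℝ) ^ 2) =
      (μ s : ℝ) * gr (e / s) / ((s : ℝ) ^ 2) *
        ∑ u ∈ (Finset.Icc 1 (T / s)).filter (fun u => Squarefree u ∧ u.Coprime (e * Q)),
          (μ u : ℝ) / ((u : ℝ) ^ 2) := by
    intro s hs
    rw [Finset.mul_sum]
    refine Finset.sum_congr rfl fun u hu => ?_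
    rw [Finset.mem_filter] at hu
    have hue : u.Coprime e := Nat.Coprime.coprime_mul_right_right hu.2.2
    have hsu : s.Coprime u := (Nat.Coprime.coprime_dvd_left (Nat.dvd_of_mem_divisors hs) hue.symm)
    rw [gcd_eq_of_dvd_of_coprime (Nat.dvd_of_mem_divisors hs) hue,
      ArithmeticFunction.isMultiplicative_moebius.map_mul_of_coprime hsu]
    push_cast
    have hs0 : (s : ℝ) ≠ 0 := by exact_mod_cast (Nat.pos_of_mem_divisors hs).ne'
    have hu0 : (u : ℝ) ≠ 0 := by
      have := (Finset.mem_Icc.mp hu.1).1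
      exact_mod_cast (show u ≠ 0 by omega)
    field_simp
  rw [hsq, hsplit, Finset.sum_congr rfl hinner]
  -- (iii) replace the inner partial sums by `Z_{eQ}`
  have htail : ∀ s ∈ e.divisors,
      |∑ u ∈ (Finset.Icc 1 (T / s)).filter (fun u => Squarefree u ∧ u.Coprime (e * Q)),
          (μ u : ℝ) / ((u : ℝ) ^ 2) - zCoprime (e * Q)| ≤ 2 * s / T := by
    intro s hs
    have hs1 : 1 ≤ s := Nat.pos_of_mem_divisors hs
    have hs0 : (0 : ℝ) < s := by exact_mod_cast hs1
    rcases Nat.eq_zero_or_pos (T / s) with hm | hm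
    · rw [hm]
      have hempty : (Finset.Icc 1 0).filter (fun u => Squarefree u ∧ u.Coprime (e * Q)) = ∅ := by
        ext u; simp
      rw [hempty, Finset.sum_empty, zero_sub, abs_neg]
      have hTs : T < s := Nat.div_eq_zero_iff.mp hm |>.resolve_left (by omega)
      have : (T : ℝ) < s := by exact_mod_cast hTs
      calc |zCoprime (e * Q)| ≤ 2 := abs_zCoprime_le_two _
        _ ≤ 2 * s / T := by rw [le_div_iff₀ hT0]; nlinarith
    · rw [abs_sub_comm]
      refine (abs_zCoprime_sub_partial_le (e * Q) hm).trans ?_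
      -- `1/(T/s) ≤ 2s/T`
      have hlt : T < T / s * s + s := Nat.lt_div_mul_add (by omega)
      have hm1 : (1 : ℝ) ≤ (T / s : ℕ) := by exact_mod_cast hm
      have hlt' : (T : ℝ) < (T / s : ℕ) * s + s := by exact_mod_cast hlt
      rw [div_le_div_iff₀ (by positivity) hT0]
      nlinarith
  -- (iv)+(v) the main term identity `G_e Z_{eQ} = g(e) Z_Q`
  have hG := sum_divisors_moebius_div_sq_mul_density (χ := χ) hq he
  have hge := rhoDensity_eq_div ha hirr hχ hQ2 hQa hQΔ he heQ
  have hZ := zCoprime_eq_prod_mul he heQ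
  have hPi := prod_primeFactors_one_sub_inv_sq_pos e
  have hmain : ∑ s ∈ e.divisors, (μ s : ℝ) * gr (e / s) / ((s : ℝ) ^ 2) * zCoprime (e * Q) =
      rhoDensity a b c Q e * zCoprime Q := by
    rw [← Finset.sum_mul, hge, hZ]
    have : ∑ s ∈ e.divisors, (μ s : ℝ) * gr (e / s) / ((s : ℝ) ^ 2) =
        ∑ s ∈ e.divisors, (μ s : ℝ) / ((s : ℝ) ^ 2) * gr (e / s) :=
      Finset.sum_congr rfl fun s _ => by ring
    rw [this, hG]
    field_simp
  rw [← hmain, ← Finset.sum_sub_distrib]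
  -- (iv) the error
  have hτ : ∀ s ∈ e.divisors, |gr (e / s)| ≤ (#e.divisors : ℝ) ^ 2 := by
    intro s hs
    have hes0 : e / s ≠ 0 := Nat.div_ne_zero_iff_of_dvd (Nat.dvd_of_mem_divisors hs) |>.mpr
      ⟨he0, (Nat.pos_of_mem_divisors hs).ne'⟩
    refine (abs_charDivisorDensity_le hq hes0).trans ?_
    have hle : (#(e / s).divisors : ℝ) ≤ #e.divisors := by
      exact_mod_cast Finset.card_le_card (Nat.divisors_subset_of_dvd he0 (Nat.div_dvd_of_dvd
        (Nat.dvd_of_mem_divisors hs)))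
    exact pow_le_pow_left₀ (Nat.cast_nonneg _) hle 2
  calc |∑ s ∈ e.divisors, ((μ s : ℝ) * gr (e / s) / ((s : ℝ) ^ 2) *
          ∑ u ∈ (Finset.Icc 1 (T / s)).filter (fun u => Squarefree u ∧ u.Coprime (e * Q)),
            (μ u : ℝ) / ((u : ℝ) ^ 2) -
          (μ s : ℝ) * gr (e / s) / ((s : ℝ) ^ 2) * zCoprime (e * Q))|
      ≤ ∑ s ∈ e.divisors, |(μ s : ℝ) * gr (e / s) / ((s : ℝ) ^ 2) *
          ∑ u ∈ (Finset.Icc 1 (T / s)).filter (fun u => Squarefree u ∧ u.Coprime (e * Q)),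
            (μ u : ℝ) / ((u : ℝ) ^ 2) -
          (μ s : ℝ) * gr (e / s) / ((s : ℝ) ^ 2) * zCoprime (e * Q)| :=
        Finset.abs_sum_le_sum_abs _ _
    _ ≤ ∑ s ∈ e.divisors, (#e.divisors : ℝ) ^ 2 * (2 / T) := by
        refine Finset.sum_le_sum fun s hs => ?_
        have hs1 : 1 ≤ s := Nat.pos_of_mem_divisors hs
        have hs0 : (0 : ℝ) < s := by exact_mod_cast hs1
        rw [← mul_sub, abs_mul]
        have hcoef : |(μ s : ℝ) * gr (e / s) / ((s : ℝ) ^ 2)| ≤ (#e.divisors : ℝ) ^ 2 / ((s : ℝ) ^ 2) := by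
          rw [abs_div, abs_mul, abs_of_pos (by positivity : (0 : ℝ) < (s : ℝ) ^ 2)]
          refine div_le_div_of_nonneg_right ?_ (by positivity)
          have hμ : |(μ s : ℝ)| ≤ 1 := by exact_mod_cast ArithmeticFunction.abs_moebius_le_one
          calc |(μ s : ℝ)| * |gr (e / s)| ≤ 1 * (#e.divisors : ℝ) ^ 2 :=
                mul_le_mul hμ (hτ s hs) (abs_nonneg _) zero_le_one
            _ = _ := one_mul _
        calc |(μ s : ℝ) * gr (e / s) / ((s : ℝ) ^ 2)| *
              |∑ u ∈ (Finset.Icc 1 (T / s)).filter (fun u => Squarefree u ∧ u.Coprime (e * Q)),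
                (μ u : ℝ) / ((u : ℝ) ^ 2) - zCoprime (e * Q)|
            ≤ (#e.divisors : ℝ) ^ 2 / ((s : ℝ) ^ 2) * (2 * s / T) :=
              mul_le_mul hcoef (htail s hs) (abs_nonneg _) (by positivity)
          _ = (#e.divisors : ℝ) ^ 2 * (2 / T) * (1 / s) := by
              field_simp
          _ ≤ (#e.divisors : ℝ) ^ 2 * (2 / T) * 1 := by
              refine mul_le_mul_of_nonneg_left ?_ (by positivity)
              rw [div_le_one hs0]; exact_mod_cast hs1
          _ = _ := mul_one _
    _ = 2 * (#e.divisors : ℝ) ^ 3 / T := by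
        rw [Finset.sum_const, nsmul_eq_mul]; ring

end MainEstimate

/-! ### J. The level of distribution of `ρ_G` on the integers prime to `Q` -/

section LevelRho

open ArithmeticFunction Iwaniec1978
open scoped ArithmeticFunction.Moebius NumberTheorySymbols
open Literature.NumberTheory.LFunctions (DirichletAbel.reChar RealChar.charDivisorSum
  RealChar.charDivisorDensity RealChar.abs_congrSum_charDivisorSum_sub_le
  RealChar.isMultiplicative_charDivisorDensity RealChar.abs_charDivisorSum_le
  RealChar.charDivisorSum_nonneg)

variable {a b c : ℤ} {Q : ℕ}
variable {χ : DirichletCharacter ℂ (4 * (b ^ 2 - 4 * a * c).natAbs)}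

/-- `τ(mn) ≤ τ(m) τ(n)` (the divisors of `mn` are products of divisors). [folklore] -/
theorem card_divisors_mul_le (m n : ℕ) : #(m * n).divisors ≤ #m.divisors * #n.divisors := by
  rw [Nat.divisors_mul]
  exact Finset.card_mul_le

/-- `∑_{n ≤ V} τ(n)/n ≤ (1 + log V)²`. [folklore] -/
theorem sum_card_divisors_div_le' (V : ℕ) :
    ∑ n ∈ Finset.Icc 1 V, ((Nat.divisors n).card : ℝ) / n ≤ (1 + Real.log V) ^ 2 := by
  have h1 : ∑ n ∈ Finset.Icc 1 V, ((Nat.divisors n).card : ℝ) / n =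
      ∑ n ∈ Finset.Icc 1 V, ∑ x ∈ Nat.divisorsAntidiagonal n, (1 : ℝ) / (x.1 * x.2) := by
    refine Finset.sum_congr rfl fun n hn => ?_
    have : ∀ x ∈ Nat.divisorsAntidiagonal n, (1 : ℝ) / (x.1 * x.2) = 1 / n := by
      intro x hx
      rw [Nat.mem_divisorsAntidiagonal] at hx
      rw [← hx.1]; push_cast; rfl
    have hcard : (Nat.divisorsAntidiagonal n).card = n.divisors.card := by
      rw [← Nat.map_div_right_divisors, Finset.card_map]
    rw [Finset.sum_congr rfl this, Finset.sum_const, nsmul_eq_mul, hcard]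
    ring
  rw [h1, SquarefreeSums.sum_Icc_sum_divisorsAntidiagonal (fun a b => (1 : ℝ) / (a * b)) V]
  have hharm : ∑ a ∈ Finset.Icc 1 V, (1 : ℝ) / a ≤ 1 + Real.log V := by
    have := harmonic_le_one_add_log V
    rw [harmonic_eq_sum_Icc] at this
    push_cast at this
    simpa [one_div] using this
  have hpos : 0 ≤ ∑ a ∈ Finset.Icc 1 V, (1 : ℝ) / a := Finset.sum_nonneg fun _ _ => by positivity
  calc ∑ a ∈ Finset.Icc 1 V, ∑ b ∈ Finset.Icc 1 (V / a), (1 : ℝ) / (a * b)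
      ≤ ∑ a ∈ Finset.Icc 1 V, ∑ b ∈ Finset.Icc 1 V, (1 : ℝ) / (a * b) := by
        refine Finset.sum_le_sum fun a _ => ?_
        exact Finset.sum_le_sum_of_subset_of_nonneg (Finset.Icc_subset_Icc_right (Nat.div_le_self _ _))
          fun _ _ _ => by positivity
    _ = (∑ a ∈ Finset.Icc 1 V, (1 : ℝ) / a) ^ 2 := by
        rw [pow_two, Finset.sum_mul_sum]
        refine Finset.sum_congr rfl fun a _ => Finset.sum_congr rfl fun b _ => ?_
        rw [one_div_mul_one_div]
    _ ≤ (1 + Real.log V) ^ 2 := pow_le_pow_left₀ hpos hharm 2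

/-- `∑_{t ≤ T} 1/t ≤ 1 + log T`. [folklore] -/
theorem sum_Icc_inv_le_log (T : ℕ) : ∑ t ∈ Finset.Icc 1 T, (1 : ℝ) / t ≤ 1 + Real.log T := by
  have := harmonic_le_one_add_log T
  rw [harmonic_eq_sum_Icc] at this
  push_cast at this
  simpa [one_div] using this

/-- `N / ⌊√N⌋ ≤ 4 √N` for `N ≥ 1`. [folklore] -/
theorem div_sqrt_le {N : ℕ} (hN : 1 ≤ N) : (N : ℝ) / (Nat.sqrt N : ℕ) ≤ 4 * Real.sqrt N := by
  set T := Nat.sqrt N with hT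
  have hT1 : 1 ≤ T := Nat.le_sqrt.mpr (by simpa using hN)
  have hT0 : (0 : ℝ) < T := by exact_mod_cast hT1
  have hNlt : N < (T + 1) * (T + 1) := Nat.lt_succ_sqrt N
  have hNlt' : (N : ℝ) < ((T : ℝ) + 1) * ((T : ℝ) + 1) := by exact_mod_cast hNlt
  have hTle : (T : ℝ) * T ≤ N := by exact_mod_cast Nat.sqrt_le N
  have hTsq : (T : ℝ) ≤ Real.sqrt N := Real.le_sqrt_of_sq_le (by rw [pow_two]; exact hTle)
  rw [div_le_iff₀ hT0]
  have h1 : (1 : ℝ) ≤ T := by exact_mod_cast hT1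
  nlinarith

/-- `0 ≤ g(e) ≤ 1` for the sieve density `g = rhoDensity`. [folklore] -/
theorem rhoDensity_nonneg_le_one (a b c : ℤ) (Q : ℕ) (e : ℕ) :
    0 ≤ rhoDensity a b c Q e ∧ rhoDensity a b c Q e ≤ 1 := by
  rcases eq_or_ne e 0 with rfl | he
  · simp
  rw [rhoDensity, ArithmeticFunction.prodPrimeFactors_apply he]
  constructor
  · exact Finset.prod_nonneg fun p hp => by
      have := (rhoDensity_prime_nonneg_lt_one a b c Q (Nat.prime_of_mem_primeFactors hp)).1
      rwa [rhoDensity_prime a b c Q (Nat.prime_of_mem_primeFactors hp)] at this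
  · refine Finset.prod_le_one (fun p hp => ?_) fun p hp => ?_
    · have := (rhoDensity_prime_nonneg_lt_one a b c Q (Nat.prime_of_mem_primeFactors hp)).1
      rwa [rhoDensity_prime a b c Q (Nat.prime_of_mem_primeFactors hp)] at this
    · have := (rhoDensity_prime_nonneg_lt_one a b c Q (Nat.prime_of_mem_primeFactors hp)).2
      rw [rhoDensity_prime a b c Q (Nat.prime_of_mem_primeFactors hp)] at this
      exact this.le

/-- **Level of distribution of `ρ_G` restricted to `(n, Q) = 1`, over the multiples of `e`.**  For
`G = aX² + bX + c` irreducible (`a > 0`), `χ = χ_Δ`, a squarefree bad modulus `Q` (even, divisible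
by the primes dividing `aΔ`, outside which `ρ_G(p^k) = ρ_G(p)`), `e` squarefree prime to `Q`, and
`N ≥ 1`:
`|∑_{n ≤ N, e ∣ n, (n,Q)=1} ρ_G(n) − L(1,χ) F_Q Z_Q g(e) N| ≤ (5q₀ τ(Q)³ (1 + log N) + 8 |L(1,χ) F_Q|) τ(e)³ √N`,
`F_Q = ∑_{f ∣ Q} μ(f) g_r(f)`, `q₀ = 4|Δ|`, `g = rhoDensity`. [folklore] -/
theorem abs_rhoSum_sub_main_le (ha : 0 < a) (hirr : Irreducible (quadPoly a b c))
    (hχ : ∀ n : ℕ, Odd n → χ n = (J(b ^ 2 - 4 * a * c | n) : ℂ))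
    (hQ0 : Q ≠ 0) (hQ2 : 2 ∣ Q) (hQa : ∀ p : ℕ, p.Prime → (p : ℤ) ∣ a → p ∣ Q)
    (hQΔ : ∀ p : ℕ, p.Prime → (p : ℤ) ∣ b ^ 2 - 4 * a * c → p ∣ Q)
    (hpow : ∀ p : ℕ, p.Prime → ¬ p ∣ Q → ∀ k : ℕ, 1 ≤ k → rhoG a b c (p ^ k) = rhoG a b c p)
    [NeZero (4 * (b ^ 2 - 4 * a * c).natAbs)]
    {e : ℕ} (he : Squarefree e) (heQ : e.Coprime Q) {N : ℕ} (hN : 1 ≤ N) :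
    |∑ n ∈ (Finset.Icc 1 N).filter (fun n => e ∣ n ∧ n.Coprime Q), (rhoG a b c n : ℝ) -
        (χ.LFunction 1).re * (∑ f ∈ Q.divisors, (μ f : ℝ) * RealChar.charDivisorDensity χ f) *
          zCoprime Q * rhoDensity a b c Q e * N| ≤
      (5 * ((4 * (b ^ 2 - 4 * a * c).natAbs : ℕ) : ℝ) * (#Q.divisors : ℝ) ^ 3 *
          (1 + Real.log N) +
        8 * |(χ.LFunction 1).re * ∑ f ∈ Q.divisors, (μ f : ℝ) * RealChar.charDivisorDensity χ f|) *
        (#e.divisors : ℝ) ^ 3 * Real.sqrt N := by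
  have hΔ0 : b ^ 2 - 4 * a * c ≠ 0 := disc_ne_zero ha.ne' hirr
  have hq : χ ^ 2 = 1 := chi_sq_eq_one hΔ0 hχ
  have hχ1 : χ ≠ 1 := chi_ne_one ha hirr hχ
  have he0 : e ≠ 0 := he.ne_zero
  set T := Nat.sqrt N with hTdef
  have hT1 : 1 ≤ T := Nat.le_sqrt.mpr (by simpa using hN)
  have hT0 : (0 : ℝ) < T := by exact_mod_cast hT1
  have hN0 : (0 : ℝ) < N := by exact_mod_cast hN
  set q₀ : ℝ := ((4 * (b ^ 2 - 4 * a * c).natAbs : ℕ) : ℝ) with hq₀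
  have hq₀0 : 0 ≤ q₀ := by rw [hq₀]; exact Nat.cast_nonneg _
  set L : ℝ := (χ.LFunction 1).re with hL
  set gr := RealChar.charDivisorDensity χ with hgr
  set r := RealChar.charDivisorSum χ with hr
  set FQ : ℝ := ∑ f ∈ Q.divisors, (μ f : ℝ) * gr f with hFQ
  set τe : ℝ := (#e.divisors : ℝ) with hτe
  set τQ : ℝ := (#Q.divisors : ℝ) with hτQ
  have hτe1 : 1 ≤ τe := by
    rw [hτe]; exact_mod_cast Finset.card_pos.mpr ⟨1, Nat.one_mem_divisors.mpr he0⟩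
  have hτQ1 : 1 ≤ τQ := by
    rw [hτQ]; exact_mod_cast Finset.card_pos.mpr ⟨1, Nat.one_mem_divisors.mpr hQ0⟩
  rw [rhoSum_eq_sum_sqrt ha hirr hχ hQ2 hQa hQΔ hpow hQ0 he heQ N]
  -- notation for the pieces
  set S := (Finset.Icc 1 T).filter (fun t => t.Coprime Q) with hS
  set et : ℕ → ℕ := fun t => e / Nat.gcd e t with het
  set Ar : ℕ → ℕ → ℝ := fun t f =>
    ∑ k ∈ (Finset.Icc 1 (N / (t * t))).filter (fun k => et t * f ∣ k), r k with hAr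
  set Mn : ℕ → ℕ → ℝ := fun t f => gr (et t * f) * (L * ((N : ℝ) / (((t * t : ℕ) : ℝ)))) with hMn
  have hdecomp : ∑ t ∈ S, (μ t : ℝ) * ∑ f ∈ Q.divisors, (μ f : ℝ) * Ar t f =
      ∑ t ∈ S, (μ t : ℝ) * ∑ f ∈ Q.divisors, (μ f : ℝ) * Mn t f +
      ∑ t ∈ S, (μ t : ℝ) * ∑ f ∈ Q.divisors, (μ f : ℝ) * (Ar t f - Mn t f) := by
    rw [← Finset.sum_add_distrib]
    refine Finset.sum_congr rfl fun t _ => ?_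
    rw [← mul_add, ← Finset.sum_add_distrib]
    congr 1
    refine Finset.sum_congr rfl fun f _ => ?_
    ring
  -- properties of `et t`
  have het_dvd : ∀ t, et t ∣ e := fun t => Nat.div_dvd_of_dvd (Nat.gcd_dvd_left e t)
  have het_sq : ∀ t, Squarefree (et t) := fun t => Squarefree.squarefree_of_dvd (het_dvd t) he
  have het_cop : ∀ t, (et t).Coprime Q := fun t => Nat.Coprime.coprime_dvd_left (het_dvd t) heQ
  have het0 : ∀ t, et t ≠ 0 := fun t => (het_sq t).ne_zero
  have hτet : ∀ t, (#(et t).divisors : ℝ) ≤ τe := fun t => by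
    rw [hτe]; exact_mod_cast Finset.card_le_card (Nat.divisors_subset_of_dvd he0 (het_dvd t))
  -- (E₁) the error terms
  have hErr : ∀ t ∈ S, ∀ f ∈ Q.divisors,
      |(μ f : ℝ) * (Ar t f - Mn t f)| ≤ 5 * q₀ * (Real.sqrt N / t) * (τe * τQ) ^ 2 := by
    intro t ht f hf
    have ht1 : 1 ≤ t := (Finset.mem_Icc.mp (Finset.mem_filter.mp ht).1).1
    have ht0 : (0 : ℝ) < t := by exact_mod_cast ht1
    by_cases hμf : μ f = 0
    · rw [hμf]; simp only [Int.cast_zero, zero_mul, abs_zero]; positivity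
    have hfsq : Squarefree f := ArithmeticFunction.moebius_ne_zero_iff_squarefree.mp hμf
    have hfQ : f ∣ Q := Nat.dvd_of_mem_divisors hf
    have hcop : (et t).Coprime f := Nat.Coprime.coprime_dvd_right hfQ (het_cop t)
    have hdsq : Squarefree (et t * f) := (Nat.squarefree_mul hcop).mpr ⟨het_sq t, hfsq⟩
    have hd0 : et t * f ≠ 0 := hdsq.ne_zero
    -- the tree's bound at `x = N/(t²)`
    have hx : (0 : ℝ) < (N : ℝ) / ((t * t : ℕ) : ℝ) := by positivity
    have hbound := RealChar.abs_congrSum_charDivisorSum_sub_le χ hχ1 hq hdsq hx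
    have hfloor : ⌊(N : ℝ) / ((t * t : ℕ) : ℝ)⌋₊ = N / (t * t) := by
      rw [Nat.floor_div_natCast, Nat.floor_natCast]
    have hIoc : Finset.Ioc 0 (N / (t * t)) = Finset.Icc 1 (N / (t * t)) := by
      ext n; simp only [Finset.mem_Ioc, Finset.mem_Icc]; omega
    rw [hfloor, hIoc] at hbound
    have hAM : Ar t f - Mn t f = ∑ n ∈ (Finset.Icc 1 (N / (t * t))).filter (fun n => et t * f ∣ n), r n -
        gr (et t * f) * (L * ((N : ℝ) / ((t * t : ℕ) : ℝ))) := rfl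
    rw [abs_mul]
    have hμ1 : |(μ f : ℝ)| ≤ 1 := by exact_mod_cast ArithmeticFunction.abs_moebius_le_one
    have hsqrt : Real.sqrt ((N : ℝ) / ((t * t : ℕ) : ℝ)) = Real.sqrt N / t := by
      push_cast
      rw [Real.sqrt_div hN0.le, Real.sqrt_mul_self ht0.le]
    have hτd : (#(et t * f).divisors : ℝ) ≤ τe * τQ := by
      calc (#(et t * f).divisors : ℝ) ≤ (#(et t).divisors : ℝ) * #f.divisors := by
            exact_mod_cast card_divisors_mul_le _ _
        _ ≤ τe * τQ := by
            refine mul_le_mul (hτet t) ?_ (Nat.cast_nonneg _) (by linarith)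
            rw [hτQ]; exact_mod_cast Finset.card_le_card (Nat.divisors_subset_of_dvd hQ0 hfQ)
    have hsd : 1 ≤ Real.sqrt (et t * f : ℕ) := by
      rw [Real.one_le_sqrt]; exact_mod_cast Nat.one_le_iff_ne_zero.mpr hd0
    calc |(μ f : ℝ)| * |Ar t f - Mn t f| ≤ 1 * (5 * q₀ * Real.sqrt ((N : ℝ) / ((t * t : ℕ) : ℝ)) *
          (#(et t * f).divisors : ℝ) ^ 2 / Real.sqrt (et t * f : ℕ)) := by
          refine mul_le_mul hμ1 ?_ (abs_nonneg _) zero_le_one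
          rw [hAM]; exact hbound
      _ ≤ 5 * q₀ * Real.sqrt ((N : ℝ) / ((t * t : ℕ) : ℝ)) * (#(et t * f).divisors : ℝ) ^ 2 / 1 := by
          rw [one_mul]
          exact div_le_div_of_nonneg_left (by positivity) one_pos hsd
      _ = 5 * q₀ * (Real.sqrt N / t) * (#(et t * f).divisors : ℝ) ^ 2 := by rw [div_one, hsqrt]
      _ ≤ 5 * q₀ * (Real.sqrt N / t) * (τe * τQ) ^ 2 := by
          refine mul_le_mul_of_nonneg_left ?_ (by positivity)
          exact pow_le_pow_left₀ (Nat.cast_nonneg _) hτd 2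
  have hE1 : |∑ t ∈ S, (μ t : ℝ) * ∑ f ∈ Q.divisors, (μ f : ℝ) * (Ar t f - Mn t f)| ≤
      5 * q₀ * τQ ^ 3 * τe ^ 2 * Real.sqrt N * (1 + Real.log N) := by
    calc |∑ t ∈ S, (μ t : ℝ) * ∑ f ∈ Q.divisors, (μ f : ℝ) * (Ar t f - Mn t f)|
        ≤ ∑ t ∈ S, |(μ t : ℝ) * ∑ f ∈ Q.divisors, (μ f : ℝ) * (Ar t f - Mn t f)| :=
          Finset.abs_sum_le_sum_abs _ _
      _ ≤ ∑ t ∈ S, (τQ * (5 * q₀ * (Real.sqrt N / t) * (τe * τQ) ^ 2)) := by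
          refine Finset.sum_le_sum fun t ht => ?_
          rw [abs_mul]
          have hμ1 : |(μ t : ℝ)| ≤ 1 := by exact_mod_cast ArithmeticFunction.abs_moebius_le_one
          have hin : |∑ f ∈ Q.divisors, (μ f : ℝ) * (Ar t f - Mn t f)| ≤
              τQ * (5 * q₀ * (Real.sqrt N / t) * (τe * τQ) ^ 2) := by
            refine (Finset.abs_sum_le_sum_abs _ _).trans ?_
            refine (Finset.sum_le_sum (hErr t ht)).trans ?_
            rw [Finset.sum_const, nsmul_eq_mul]
          calc |(μ t : ℝ)| * |∑ f ∈ Q.divisors, (μ f : ℝ) * (Ar t f - Mn t f)|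
              ≤ 1 * (τQ * (5 * q₀ * (Real.sqrt N / t) * (τe * τQ) ^ 2)) :=
                mul_le_mul hμ1 hin (abs_nonneg _) zero_le_one
            _ = _ := one_mul _
      _ = 5 * q₀ * τQ ^ 3 * τe ^ 2 * Real.sqrt N * ∑ t ∈ S, (1 : ℝ) / t := by
          rw [Finset.mul_sum]
          refine Finset.sum_congr rfl fun t _ => ?_
          ring
      _ ≤ 5 * q₀ * τQ ^ 3 * τe ^ 2 * Real.sqrt N * (1 + Real.log N) := by
          refine mul_le_mul_of_nonneg_left ?_ (by positivity)
          calc ∑ t ∈ S, (1 : ℝ) / t ≤ ∑ t ∈ Finset.Icc 1 T, (1 : ℝ) / t :=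
                Finset.sum_le_sum_of_subset_of_nonneg (Finset.filter_subset _ _)
                  fun _ _ _ => by positivity
            _ ≤ 1 + Real.log T := sum_Icc_inv_le_log T
            _ ≤ 1 + Real.log N := by
                have : (T : ℝ) ≤ N := by exact_mod_cast Nat.sqrt_le_self N
                linarith [Real.log_le_log hT0 this]
  -- (M) the main terms
  have hMain : ∑ t ∈ S, (μ t : ℝ) * ∑ f ∈ Q.divisors, (μ f : ℝ) * Mn t f =
      L * N * FQ * ∑ t ∈ S, (μ t : ℝ) * gr (et t) / ((t : ℝ) ^ 2) := by
    rw [Finset.mul_sum]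
    refine Finset.sum_congr rfl fun t ht => ?_
    have ht1 : 1 ≤ t := (Finset.mem_Icc.mp (Finset.mem_filter.mp ht).1).1
    have ht0 : (t : ℝ) ≠ 0 := by exact_mod_cast (show t ≠ 0 by omega)
    have hin : ∑ f ∈ Q.divisors, (μ f : ℝ) * Mn t f = (L * ((N : ℝ) / ((t : ℝ) ^ 2))) * gr (et t) * FQ := by
      rw [hFQ, Finset.mul_sum]
      refine Finset.sum_congr rfl fun f hf => ?_
      simp only [hMn]
      have hcop : (et t).Coprime f :=
        Nat.Coprime.coprime_dvd_right (Nat.dvd_of_mem_divisors hf) (het_cop t)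
      rw [(RealChar.isMultiplicative_charDivisorDensity χ hq).map_mul_of_coprime hcop]
      push_cast
      ring
    rw [hin]
    ring
  have hSig := abs_singularSum_sub_le ha hirr hχ hQ2 hQa hQΔ he heQ hT1 (χ := χ)
  -- assemble
  rw [hdecomp, hMain]
  have hmainErr : |L * N * FQ * ∑ t ∈ S, (μ t : ℝ) * gr (et t) / ((t : ℝ) ^ 2) -
      L * FQ * zCoprime Q * rhoDensity a b c Q e * N| ≤ 8 * |L * FQ| * τe ^ 3 * Real.sqrt N := by
    have : L * N * FQ * ∑ t ∈ S, (μ t : ℝ) * gr (et t) / ((t : ℝ) ^ 2) -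
        L * FQ * zCoprime Q * rhoDensity a b c Q e * N =
        (L * FQ) * N * (∑ t ∈ S, (μ t : ℝ) * gr (et t) / ((t : ℝ) ^ 2) -
          rhoDensity a b c Q e * zCoprime Q) := by ring
    rw [this, abs_mul, abs_mul, abs_of_pos hN0]
    calc |L * FQ| * N * |∑ t ∈ S, (μ t : ℝ) * gr (et t) / ((t : ℝ) ^ 2) -
          rhoDensity a b c Q e * zCoprime Q| ≤ |L * FQ| * N * (2 * τe ^ 3 / T) :=
          mul_le_mul_of_nonneg_left hSig (by positivity)
      _ = |L * FQ| * τe ^ 3 * 2 * ((N : ℝ) / (T : ℕ)) := by ring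
      _ ≤ |L * FQ| * τe ^ 3 * 2 * (4 * Real.sqrt N) :=
          mul_le_mul_of_nonneg_left (div_sqrt_le hN) (by positivity)
      _ = 8 * |L * FQ| * τe ^ 3 * Real.sqrt N := by ring
  have hτe23 : τe ^ 2 ≤ τe ^ 3 := by
    calc τe ^ 2 = τe ^ 2 * 1 := (mul_one _).symm
      _ ≤ τe ^ 2 * τe := mul_le_mul_of_nonneg_left hτe1 (by positivity)
      _ = τe ^ 3 := by ring
  have hlogN : 0 ≤ Real.log N := Real.log_nonneg (by exact_mod_cast hN)
  calc |L * N * FQ * ∑ t ∈ S, (μ t : ℝ) * gr (et t) / ((t : ℝ) ^ 2) +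
        ∑ t ∈ S, (μ t : ℝ) * ∑ f ∈ Q.divisors, (μ f : ℝ) * (Ar t f - Mn t f) -
        L * FQ * zCoprime Q * rhoDensity a b c Q e * N|
      = |(L * N * FQ * ∑ t ∈ S, (μ t : ℝ) * gr (et t) / ((t : ℝ) ^ 2) -
          L * FQ * zCoprime Q * rhoDensity a b c Q e * N) +
          ∑ t ∈ S, (μ t : ℝ) * ∑ f ∈ Q.divisors, (μ f : ℝ) * (Ar t f - Mn t f)| := by ring_nf
    _ ≤ 8 * |L * FQ| * τe ^ 3 * Real.sqrt N + 5 * q₀ * τQ ^ 3 * τe ^ 2 * Real.sqrt N * (1 + Real.log N) :=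
        (abs_add_le _ _).trans (add_le_add hmainErr hE1)
    _ ≤ 8 * |L * FQ| * τe ^ 3 * Real.sqrt N + 5 * q₀ * τQ ^ 3 * τe ^ 3 * Real.sqrt N * (1 + Real.log N) := by
        gcongr
    _ = (5 * q₀ * τQ ^ 3 * (1 + Real.log N) + 8 * |L * FQ|) * τe ^ 3 * Real.sqrt N := by ring

end LevelRho

/-! ### K. Logarithmic windows, the shifted version `ρ_G(p₁m)`, and positivity of the constant -/

section Windows

open ArithmeticFunction Iwaniec1978
open scoped ArithmeticFunction.Moebius NumberTheorySymbols
open Literature.NumberTheory.LFunctions (DirichletAbel.reChar RealChar.charDivisorSum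
  RealChar.charDivisorDensity RealChar.one_sub_charDivisorDensity_prime
  RealChar.isMultiplicative_charDivisorDensity)

variable {a b c : ℤ} {Q : ℕ}
variable {χ : DirichletCharacter ℂ (4 * (b ^ 2 - 4 * a * c).natAbs)}

/-- **Logarithmic window sums of `ρ_G` over the multiples of `e`, on the integers prime to `Q`.**
For `1 ≤ U ≤ V`:
`|∑_{U<m≤V, e∣m, (m,Q)=1} ρ_G(m)/m − 𝔠 g(e) log(V/U)| ≤ 2|𝔠|/U + 4 K_V τ(e)³/√U`,
`𝔠 = L(1,χ) F_Q Z_Q`, `K_V = 5q₀τ(Q)³(1 + log V) + 8|L(1,χ)F_Q|` (partial summation,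
`abs_logSum_sub_le`, from `abs_rhoSum_sub_main_le`). [folklore] -/
theorem abs_rhoLogSum_sub_le (ha : 0 < a) (hirr : Irreducible (quadPoly a b c))
    (hχ : ∀ n : ℕ, Odd n → χ n = (J(b ^ 2 - 4 * a * c | n) : ℂ))
    (hQ0 : Q ≠ 0) (hQ2 : 2 ∣ Q) (hQa : ∀ p : ℕ, p.Prime → (p : ℤ) ∣ a → p ∣ Q)
    (hQΔ : ∀ p : ℕ, p.Prime → (p : ℤ) ∣ b ^ 2 - 4 * a * c → p ∣ Q)
    (hpow : ∀ p : ℕ, p.Prime → ¬ p ∣ Q → ∀ k : ℕ, 1 ≤ k → rhoG a b c (p ^ k) = rhoG a b c p)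
    [NeZero (4 * (b ^ 2 - 4 * a * c).natAbs)]
    {e : ℕ} (he : Squarefree e) (heQ : e.Coprime Q) {U V : ℕ} (hU : 1 ≤ U) (hUV : U ≤ V) :
    |∑ m ∈ (Finset.Ioc U V).filter (fun m => e ∣ m ∧ m.Coprime Q), (rhoG a b c m : ℝ) / m -
        (χ.LFunction 1).re * (∑ f ∈ Q.divisors, (μ f : ℝ) * RealChar.charDivisorDensity χ f) *
          zCoprime Q * rhoDensity a b c Q e * Real.log ((V : ℝ) / U)| ≤
      2 * |(χ.LFunction 1).re * (∑ f ∈ Q.divisors, (μ f : ℝ) * RealChar.charDivisorDensity χ f) *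
          zCoprime Q| / U +
        4 * ((5 * ((4 * (b ^ 2 - 4 * a * c).natAbs : ℕ) : ℝ) * (#Q.divisors : ℝ) ^ 3 *
          (1 + Real.log V) +
          8 * |(χ.LFunction 1).re * ∑ f ∈ Q.divisors, (μ f : ℝ) * RealChar.charDivisorDensity χ f|) *
          (#e.divisors : ℝ) ^ 3) / Real.sqrt U := by
  set 𝔠 : ℝ := (χ.LFunction 1).re * (∑ f ∈ Q.divisors, (μ f : ℝ) * RealChar.charDivisorDensity χ f) *
    zCoprime Q with h𝔠
  set KV : ℝ := (5 * ((4 * (b ^ 2 - 4 * a * c).natAbs : ℕ) : ℝ) * (#Q.divisors : ℝ) ^ 3 *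
    (1 + Real.log V) +
    8 * |(χ.LFunction 1).re * ∑ f ∈ Q.divisors, (μ f : ℝ) * RealChar.charDivisorDensity χ f|) with hKV
  have hV1 : 1 ≤ V := hU.trans hUV
  have hlogV : 0 ≤ Real.log V := Real.log_nonneg (by exact_mod_cast hV1)
  have hKV0 : 0 ≤ KV := by rw [hKV]; positivity
  set aa : ℕ → ℝ := fun n => if e ∣ n ∧ n.Coprime Q then (rhoG a b c n : ℝ) else 0 with haa
  have hA : ∀ N : ℕ, 1 ≤ N → N ≤ V → |∑ n ∈ Finset.Ioc 0 N, aa n - 𝔠 * rhoDensity a b c Q e * N| ≤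
      KV * (#e.divisors : ℝ) ^ 3 * Real.sqrt N := by
    intro N hN hNV
    have h := abs_rhoSum_sub_main_le ha hirr hχ hQ0 hQ2 hQa hQΔ hpow he heQ hN (χ := χ)
    have hIoc : Finset.Ioc 0 N = Finset.Icc 1 N := by
      ext n; simp only [Finset.mem_Ioc, Finset.mem_Icc]; omega
    rw [hIoc, haa, ← Finset.sum_filter]
    have hmain : 𝔠 * rhoDensity a b c Q e * N = (χ.LFunction 1).re *
        (∑ f ∈ Q.divisors, (μ f : ℝ) * RealChar.charDivisorDensity χ f) *
          zCoprime Q * rhoDensity a b c Q e * N := by rw [h𝔠]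
    rw [hmain]
    refine h.trans ?_
    have hlogN : Real.log N ≤ Real.log V :=
      Real.log_le_log (by exact_mod_cast hN) (by exact_mod_cast hNV)
    have hτ : 0 ≤ (#e.divisors : ℝ) ^ 3 := by positivity
    have hs : 0 ≤ Real.sqrt N := Real.sqrt_nonneg _
    rw [hKV]
    apply mul_le_mul_of_nonneg_right _ hs
    apply mul_le_mul_of_nonneg_right _ hτ
    gcongr
  have h := abs_logSum_sub_le (a := aa) (c := 𝔠 * rhoDensity a b c Q e)
    (B := KV * (#e.divisors : ℝ) ^ 3) (by positivity) hA hU hUV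
  have hsum : ∑ m ∈ (Finset.Ioc U V).filter (fun m => e ∣ m ∧ m.Coprime Q), (rhoG a b c m : ℝ) / m =
      ∑ n ∈ Finset.Ioc U V, aa n / n := by
    rw [Finset.sum_filter]
    refine Finset.sum_congr rfl fun n _ => ?_
    simp only [haa]
    split_ifs <;> simp
  rw [hsum]
  have hg := rhoDensity_nonneg_le_one a b c Q e
  have hU0 : (0 : ℝ) < U := by exact_mod_cast hU
  calc |∑ n ∈ Finset.Ioc U V, aa n / n - 𝔠 * rhoDensity a b c Q e * Real.log ((V : ℝ) / U)|
      ≤ 2 * |𝔠 * rhoDensity a b c Q e| / U + 4 * (KV * (#e.divisors : ℝ) ^ 3) / Real.sqrt U := h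
    _ ≤ 2 * |𝔠| / U + 4 * (KV * (#e.divisors : ℝ) ^ 3) / Real.sqrt U := by
        have hle : |𝔠 * rhoDensity a b c Q e| ≤ |𝔠| := by
          rw [abs_mul, abs_of_nonneg hg.1]
          exact mul_le_of_le_one_right (abs_nonneg _) hg.2
        have : 2 * |𝔠 * rhoDensity a b c Q e| / U ≤ 2 * |𝔠| / U := by
          refine div_le_div_of_nonneg_right ?_ hU0.le
          linarith
        linarith

/-- **The shifted version**: for a prime `p₁ ∤ Q`, replacing `ρ_G(m)` by `ρ_G(p₁ m)` multiplies the
sum by `ρ_G(p₁)` up to the terms with `p₁ ∣ m`: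
`|∑_{U<m≤V, e∣m, (m,Q)=1} ρ_G(p₁m)/m − ρ_G(p₁) ∑_{U<m≤V, e∣m, (m,Q)=1} ρ_G(m)/m| ≤ 8 (1 + log V)²/p₁`.
[folklore] -/
theorem abs_rhoLogSum_prime_mul_sub_le (ha : 0 < a) (hirr : Irreducible (quadPoly a b c))
    (hχ : ∀ n : ℕ, Odd n → χ n = (J(b ^ 2 - 4 * a * c | n) : ℂ))
    (hQ2 : 2 ∣ Q) (hQa : ∀ p : ℕ, p.Prime → (p : ℤ) ∣ a → p ∣ Q)
    (hpow : ∀ p : ℕ, p.Prime → ¬ p ∣ Q → ∀ k : ℕ, 1 ≤ k → rhoG a b c (p ^ k) = rhoG a b c p)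
    {p₁ : ℕ} (hp₁ : p₁.Prime) (hp₁Q : ¬ p₁ ∣ Q) (e U V : ℕ) :
    |∑ m ∈ (Finset.Ioc U V).filter (fun m => e ∣ m ∧ m.Coprime Q), (rhoG a b c (p₁ * m) : ℝ) / m -
        (rhoG a b c p₁ : ℝ) *
          ∑ m ∈ (Finset.Ioc U V).filter (fun m => e ∣ m ∧ m.Coprime Q), (rhoG a b c m : ℝ) / m| ≤
      8 * (1 + Real.log V) ^ 2 / p₁ := by
  have hp0 : (0 : ℝ) < p₁ := by exact_mod_cast hp₁.pos
  have hp₁cop : p₁.Coprime Q := (Nat.Prime.coprime_iff_not_dvd hp₁).mpr hp₁Q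
  rw [Finset.mul_sum, ← Finset.sum_sub_distrib]
  -- the terms with `p₁ ∤ m` vanish
  have hterm : ∀ m ∈ (Finset.Ioc U V).filter (fun m => e ∣ m ∧ m.Coprime Q),
      |(rhoG a b c (p₁ * m) : ℝ) / m - (rhoG a b c p₁ : ℝ) * ((rhoG a b c m : ℝ) / m)| ≤
        if p₁ ∣ m then 4 * (#m.divisors : ℝ) / m else 0 := by
    intro m hm
    rw [Finset.mem_filter, Finset.mem_Ioc] at hm
    have hm1 : 1 ≤ m := by omega
    have hm0 : (0 : ℝ) < m := by exact_mod_cast hm1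
    split_ifs with hpm
    · -- `p₁ ∣ m`: crude bound `ρ(p₁m) + ρ(p₁)ρ(m) ≤ 2τ(m) + 2τ(m)`
      have hpmQ : (p₁ * m).Coprime Q := Nat.Coprime.mul_left hp₁cop hm.2.2
      have h1 : (rhoG a b c (p₁ * m) : ℝ) ≤ 2 * #m.divisors := by
        have := rhoG_le_card_divisors ha hirr hχ hQ2 hQa hpow hpmQ
          (mul_ne_zero hp₁.ne_zero (by omega))
        calc (rhoG a b c (p₁ * m) : ℝ) ≤ #(p₁ * m).divisors := by exact_mod_cast this
          _ ≤ #p₁.divisors * #m.divisors := by exact_mod_cast card_divisors_mul_le p₁ m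
          _ = 2 * #m.divisors := by rw [Nat.Prime.divisors hp₁, Finset.card_pair hp₁.one_lt.ne]; norm_num
      have h2 : (rhoG a b c p₁ : ℝ) ≤ 2 := by
        have := rhoG_le_card_divisors ha hirr hχ hQ2 hQa hpow hp₁cop hp₁.ne_zero
        rw [Nat.Prime.divisors hp₁, Finset.card_pair hp₁.one_lt.ne] at this
        exact_mod_cast this
      have h3 : (rhoG a b c m : ℝ) ≤ #m.divisors := by
        exact_mod_cast rhoG_le_card_divisors ha hirr hχ hQ2 hQa hpow hm.2.2 (by omega)
      have hρ0 : (0 : ℝ) ≤ rhoG a b c (p₁ * m) := Nat.cast_nonneg _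
      have hρ1 : (0 : ℝ) ≤ rhoG a b c p₁ := Nat.cast_nonneg _
      have hρ2 : (0 : ℝ) ≤ rhoG a b c m := Nat.cast_nonneg _
      rw [← mul_div_assoc, ← sub_div, abs_div, abs_of_pos hm0]
      refine div_le_div_of_nonneg_right ?_ hm0.le
      rw [abs_le]
      constructor <;> nlinarith
    · -- `p₁ ∤ m`: multiplicativity
      have hcop : p₁.Coprime m := (Nat.Prime.coprime_iff_not_dvd hp₁).mpr hpm
      have hmul : (rhoG a b c (p₁ * m) : ℝ) = rhoG a b c p₁ * rhoG a b c m := by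
        have := isMultiplicative_rhoArith.map_mul_of_coprime (f := rhoArith a b c) hcop
        simpa [rhoArith_apply] using this
      rw [hmul]
      have : (rhoG a b c p₁ : ℝ) * rhoG a b c m / m - rhoG a b c p₁ * (rhoG a b c m / m) = 0 := by ring
      rw [this, abs_zero]
  refine (Finset.abs_sum_le_sum_abs _ _).trans ((Finset.sum_le_sum hterm).trans ?_)
  rw [← Finset.sum_filter]
  -- the multiples of `p₁` in `(U, V]`: `m = p₁ m'`, `m' ≤ V/p₁`
  calc ∑ m ∈ ((Finset.Ioc U V).filter (fun m => e ∣ m ∧ m.Coprime Q)).filter (fun m => p₁ ∣ m),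
        4 * (#m.divisors : ℝ) / m
      ≤ ∑ m ∈ (Finset.Icc 1 V).filter (fun m => p₁ ∣ m), 4 * (#m.divisors : ℝ) / m := by
        refine Finset.sum_le_sum_of_subset_of_nonneg ?_ fun _ _ _ => by positivity
        intro m hm
        simp only [Finset.mem_filter, Finset.mem_Ioc, Finset.mem_Icc] at hm ⊢
        exact ⟨⟨by omega, hm.1.1.2⟩, hm.2⟩
    _ = ∑ m' ∈ Finset.Icc 1 (V / p₁), 4 * (#(p₁ * m').divisors : ℝ) / (p₁ * m' : ℕ) := by
        symm
        refine Finset.sum_nbij' (fun m' => p₁ * m') (fun m => m / p₁) ?_ ?_ ?_ ?_ ?_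
        · intro m' hm'
          rw [Finset.mem_Icc] at hm'
          rw [Finset.mem_filter, Finset.mem_Icc]
          refine ⟨⟨Nat.one_le_iff_ne_zero.mpr (mul_ne_zero hp₁.ne_zero (by omega)), ?_⟩,
            dvd_mul_right _ _⟩
          exact (Nat.le_div_iff_mul_le hp₁.pos).mp hm'.2 |> fun h => by rw [mul_comm]; exact h
        · intro m hm
          rw [Finset.mem_filter, Finset.mem_Icc] at hm
          rw [Finset.mem_Icc]
          obtain ⟨k, hk⟩ := hm.2
          rw [hk, Nat.mul_div_cancel_left _ hp₁.pos]
          constructor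
          · by_contra h0; push Not at h0
            have : k = 0 := by omega
            rw [this, mul_zero] at hk; omega
          · rw [Nat.le_div_iff_mul_le hp₁.pos, mul_comm, ← hk]; exact hm.1.2
        · intro m' _; simp [Nat.mul_div_cancel_left _ hp₁.pos]
        · intro m hm
          rw [Finset.mem_filter] at hm
          exact Nat.mul_div_cancel' hm.2
        · intro m' _; rfl
    _ ≤ ∑ m' ∈ Finset.Icc 1 (V / p₁), (8 / p₁) * ((#m'.divisors : ℝ) / m') := by
        refine Finset.sum_le_sum fun m' hm' => ?_
        have hm'1 : 1 ≤ m' := (Finset.mem_Icc.mp hm').1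
        have hm'0 : (0 : ℝ) < m' := by exact_mod_cast hm'1
        have hτ : (#(p₁ * m').divisors : ℝ) ≤ 2 * #m'.divisors := by
          calc (#(p₁ * m').divisors : ℝ) ≤ #p₁.divisors * #m'.divisors := by
                exact_mod_cast card_divisors_mul_le p₁ m'
            _ = 2 * #m'.divisors := by
                rw [Nat.Prime.divisors hp₁, Finset.card_pair hp₁.one_lt.ne]; norm_num
        push_cast
        rw [div_le_iff₀ (by positivity)]
        calc 4 * (#(p₁ * m').divisors : ℝ) ≤ 4 * (2 * #m'.divisors) := by linarith
          _ = 8 / p₁ * ((#m'.divisors : ℝ) / m') * (p₁ * m') := by field_simp; ring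
    _ = (8 / p₁) * ∑ m' ∈ Finset.Icc 1 (V / p₁), (#m'.divisors : ℝ) / m' := by
        rw [Finset.mul_sum]
    _ ≤ (8 / p₁) * ∑ m' ∈ Finset.Icc 1 V, (#m'.divisors : ℝ) / m' := by
        refine mul_le_mul_of_nonneg_left ?_ (by positivity)
        exact Finset.sum_le_sum_of_subset_of_nonneg (Finset.Icc_subset_Icc_right (Nat.div_le_self _ _))
          fun _ _ _ => by positivity
    _ ≤ (8 / p₁) * (1 + Real.log V) ^ 2 :=
        mul_le_mul_of_nonneg_left (sum_card_divisors_div_le' V) (by positivity)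
    _ = 8 * (1 + Real.log V) ^ 2 / p₁ := by ring

/-- **Positivity of the constant**: `L(1, χ) > 0` (quadratic `χ ≠ χ₀`, the tree's
`Siegel.LFunction_one_re_pos`), `F_Q = ∏_{p ∣ Q} (1 − 1/p)(1 − χ(p)/p) > 0` for squarefree `Q`,
and `Z_Q ≥ 1/3`; hence `𝔠 = L(1,χ) F_Q Z_Q > 0`. [folklore] -/
theorem const_pos (ha : 0 < a) (hirr : Irreducible (quadPoly a b c))
    (hχ : ∀ n : ℕ, Odd n → χ n = (J(b ^ 2 - 4 * a * c | n) : ℂ))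
    [NeZero (4 * (b ^ 2 - 4 * a * c).natAbs)] (hQ : Squarefree Q) :
    0 < (χ.LFunction 1).re * (∑ f ∈ Q.divisors, (μ f : ℝ) * RealChar.charDivisorDensity χ f) *
      zCoprime Q := by
  have hΔ0 : b ^ 2 - 4 * a * c ≠ 0 := disc_ne_zero ha.ne' hirr
  have hq : χ ^ 2 = 1 := chi_sq_eq_one hΔ0 hχ
  have hχ1 : χ ≠ 1 := chi_ne_one ha hirr hχ
  have hL : 0 < (χ.LFunction 1).re :=
    Literature.NumberTheory.LFunctions.Siegel.LFunction_one_re_pos χ hχ1 hq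
  have hF : 0 < ∑ f ∈ Q.divisors, (μ f : ℝ) * RealChar.charDivisorDensity χ f := by
    rw [← ArithmeticFunction.IsMultiplicative.prodPrimeFactors_one_sub_of_squarefree _
      (RealChar.isMultiplicative_charDivisorDensity χ hq) hQ]
    refine Finset.prod_pos fun p hp => ?_
    have hp' := Nat.prime_of_mem_primeFactors hp
    rw [RealChar.one_sub_charDivisorDensity_prime χ hq hp']
    have hp2 : (2 : ℝ) ≤ p := by exact_mod_cast hp'.two_le
    have h1 : 0 < 1 - ((p : ℝ))⁻¹ := by
      rw [sub_pos, inv_lt_one_iff₀]; right; linarith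
    have h2 : 0 < 1 - DirichletAbel.reChar χ p / p := by
      have := Literature.NumberTheory.LFunctions.DirichletAbel.abs_reChar_le_one χ p
      rw [abs_le] at this
      rw [sub_pos, div_lt_one (by linarith)]; linarith
    exact mul_pos h1 h2
  have hZ := one_third_le_zCoprime Q
  exact mul_pos (mul_pos hL hF) (by linarith)

end Windows

end RhoLogSums

end Literature.NumberTheory.Sieve

end
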